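import Literature.Analysis.FluidPDE.TaoEnstrophyLocalisationProofs
import Literature.Analysis.FluidPDE.DivCurlL2
import Literature.Analysis.FluidPDE.SobolevWholeSpace
import Literature.Analysis.FluidPDE.EnergyToolkit
import Literature.Analysis.FluidPDE.LeraySeparationOfEnergyTools
import Literature.Analysis.FluidPDE.LerayProfileCalculus
import Literature.Analysis.FluidPDE.AncientSimilarityVorticity
import HarnessLib

/-!
# Small local enstrophy forces a Leray-type profile flow to be irrotational
  (Pineau–Vicol 2026, Proposition 3.1 / (3.4) and the period argument (7.12), α-free form)

Analysis/FluidPDE support file (all results proved; no named facts) in the discharge programme of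
`Literature.Analysis.FluidPDE.pineauVicol2026_rdss_liouville` (B. Pineau, V. Vicol,
arXiv:2607.09619 (2026), Thm. 1.7). Section 3 of the source reduces the Liouville theorem to the
smallness of the local enstrophy `‖Ω‖_{L²(B_R̄)}` of the profile (Proposition 3.1, estimate (3.4)),
and §7.5 runs the same absorption for the time-periodic (RDSS) profile after integrating the
enstrophy identity (7.12) over a period. This file proves both steps, in the **rotation-free
backward similarity variables** of the tree (`lerayOrbit`, `IsBackwardLeraySolutionOn`,
`AncientSimilarityVariables` / `AncientSimilarityVorticity`): the source's profile `U(y,s)` is the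
conjugate `R(−αs) V(R(αs)y, s)` of the Leray-variables profile `V`, all the quantities below are
rotation invariant, and in the `V`-frame the terms `α(JΩ − (Jy·∇)Ω)·Ω` of (3.3)/(7.12) (which
vanish identically anyway) never appear.

* **Functional inequalities on `ℝ³`** (whole space, no compact support):
  `memLp_six_and_integral_norm_pow_six_le` (`Ḣ¹ ⊂ L⁶`, from the tree's
  `eLpNorm_six_le_eLpNorm_fderiv_two`), `memLp_four_and_integral_norm_pow_four_le`
  (`‖g‖₄⁴ ≤ K³‖g‖₂ ‖Dg‖₂³`); the `div`–`curl` bounds `∫|DU|²_F ≤ ∫|curl U|²` for divergence-free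
  `U ∈ L⁴` (`integral_frobeniusNormSq_fderiv_le`, from `DivCurlL2`) and, at second order,
  `∫|D∂ₖU|²_F ≤ ∫|∂ₖ curl U|²` (`integral_frobeniusNormSq_fderiv_column_le`, from
  `TaoEnstrophyLocalisationProofs`), whence `∫‖DU‖⁴ ≤ 9K³ ‖Ω‖₂ ‖DΩ‖₂³`
  (`integral_norm_fderiv_pow_four_le`) — this replaces the Calderón–Zygmund bound
  `‖∇U‖_{L⁴} ≤ C′‖Ω‖_{L⁴}` used in the source.
* **The vortex-stretching estimate (3.4)** `integral_inner_curl_fderiv_curl_le`: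
  `∫ Ω·(DU)Ω ≤ ⅛‖Ω‖₂² + C_Ω ‖Ω‖_{L²(B_R̄)} (‖Ω‖₂² + ‖DΩ‖₂²)` whenever `‖DU‖ ≤ ⅛` off `B_R̄`, with
  the universal constant `vortexConst = √3 K^{3/2}`.
* **Whole-space integrations by parts** under integrability (not compact support):
  `integral_divergence_eq_zero_of_integrable_div` (`∫ div F = 0` when `div F ∈ L¹` and only
  `‖F‖/(1+|y|) ∈ L¹` — the flux `½|Ω|²y` of the dilation term is not integrable),
  `integral_inner_fderiv_apply_self_eq_zero_of_bounded` (`∫⟪(W·∇)Ω,Ω⟫ = 0`, bounded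
  divergence-free wind), `integral_inner_fderiv_apply_id_self_eq` (`∫⟪(y·∇)Ω,Ω⟫ = −(d/2)‖Ω‖₂²`),
  `integral_inner_laplacian_self_eq_neg` (`∫⟪ΔΩ,Ω⟫ = −∫|DΩ|²_F`).
* **The enstrophy identity, one slice** (`enstrophy_slice`, (7.12) without `α`): for a classical
  solution of the backward Leray system on `ℝ × ℝ³`,
  `∫⟪∂ₛΩ,Ω⟫ + ¼‖Ω‖₂² + ‖DΩ‖²_F = ∫⟪Ω,(DV)Ω⟫` (from the tree's vorticity equation
  `IsBackwardLeraySolutionOn.vorticity_eq`).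
* **Absorption over a period** (`curl_eq_zero_of_small_local_enstrophy`, §7.5): if on `[0,S]`
  the slices satisfy the above hypotheses, `‖Ω(s)‖_{L²(B_R̄)} ≤ δ` with `C_Ω δ < ⅛`, and the time
  term integrates to zero over the period, then `Ω ≡ 0` on `[0,S] × ℝ³`.

## References

* B. Pineau, V. Vicol, arXiv:2607.09619 (2026): Proposition 3.1, (3.3)–(3.4) (p. 10–11), §7.5,
  (7.12) (p. 27). [PineauVicol2026]
* A. J. Majda, A. L. Bertozzi, *Vorticity and Incompressible Flow* (CUP 2002), §3.1.1
  (integrations by parts for the energy/enstrophy identities). [MajdaBertozziCUP2002]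
* L. C. Evans, *Partial Differential Equations*, 2nd ed. (2010), §5.6.1 (Gagliardo–Nirenberg–Sobolev).
  [Evans2010]
-/

noncomputable section

open MeasureTheory TopologicalSpace Set Function Filter Topology InnerProductSpace Real Module
open scoped RealInnerProductSpace ENNReal NNReal ContDiff Laplacian

namespace Literature.Analysis.FluidPDE

namespace PineauVicol2026

/-- Local notation for physical space `ℝ³ = EuclideanSpace ℝ (Fin 3)`. -/
local notation "ℝ³" => EuclideanSpace ℝ (Fin 3)

section Sobolev

variable {F : Type*} [NormedAddCommGroup F] [NormedSpace ℝ F] [FiniteDimensional ℝ F]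

/-- The Sobolev constant `K_F` of `‖g‖_{L⁶(ℝ³;F)} ≤ K_F ‖Dg‖_{L²}` (Mathlib's, for the codomain `F`). [folklore] -/
abbrev sobolevSix (F : Type*) [NormedAddCommGroup F] [NormedSpace ℝ F] [FiniteDimensional ℝ F] : ℝ :=
  (SNormLESNormFDerivOfEqConst F (volume : Measure ℝ³) 2 : ℝ≥0)

omit [NormedSpace ℝ F] [FiniteDimensional ℝ F] in
/-- For `g ∈ L^p`, `‖g‖_{L^p} = ofReal ((∫‖g‖^p)^{1/p})` (`p ≥ 1` a natural number). [folklore] -/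
theorem eLpNorm_eq_ofReal_rpow_of_memLp {g : ℝ³ → F} {p : ℕ} (hp : p ≠ 0) (hg : MemLp g p volume) :
    eLpNorm g p volume = ENNReal.ofReal ((∫ x, ‖g x‖ ^ p) ^ (p : ℝ)⁻¹) := by
  rw [hg.eLpNorm_eq_integral_rpow_norm (by exact_mod_cast hp) (by simp)]
  simp [Real.rpow_natCast]

/-- **Sobolev `Ḣ¹ ⊂ L⁶` on `ℝ³`, integral form, whole space**: for `g ∈ C¹` with `g, Dg ∈ L²`,
`g ∈ L⁶` and `∫‖g‖⁶ ≤ K⁶ (∫‖Dg‖²)³`. [cite: Evans2010, §5.6.1 Thm. 1–2] -/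
theorem memLp_six_and_integral_norm_pow_six_le {g : ℝ³ → F} (hg : ContDiff ℝ 1 g)
    (h2 : MemLp g 2 volume) (hD : MemLp (fderiv ℝ g) 2 volume) :
    MemLp g 6 volume ∧ ∫ x, ‖g x‖ ^ 6 ≤ sobolevSix F ^ 6 * (∫ x, ‖fderiv ℝ g x‖ ^ 2) ^ 3 := by
  have hE : finrank ℝ ℝ³ = 3 := by simp
  have hS := eLpNorm_six_le_eLpNorm_fderiv_two (volume : Measure ℝ³) hE hg h2.eLpNorm_lt_top
  have h6 : MemLp g 6 volume := by
    refine ⟨hg.continuous.aestronglyMeasurable, lt_of_le_of_lt hS ?_⟩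
    exact ENNReal.mul_lt_top ENNReal.coe_lt_top hD.eLpNorm_lt_top
  refine ⟨h6, ?_⟩
  have e6 := eLpNorm_eq_ofReal_rpow_of_memLp (p := 6) (by norm_num) h6
  have e2 := eLpNorm_eq_ofReal_rpow_of_memLp (p := 2) (by norm_num) hD
  push_cast at e6 e2
  rw [e6, e2, ← ENNReal.ofReal_coe_nnreal, ← ENNReal.ofReal_mul (NNReal.coe_nonneg _)] at hS
  have hI : 0 ≤ ∫ x, ‖g x‖ ^ 6 := integral_nonneg fun _ => pow_nonneg (norm_nonneg _) _
  have hJ : 0 ≤ ∫ x, ‖fderiv ℝ g x‖ ^ 2 := integral_nonneg fun _ => sq_nonneg _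
  have hK : 0 ≤ sobolevSix F := NNReal.coe_nonneg _
  have h := (ENNReal.ofReal_le_ofReal_iff (mul_nonneg hK (Real.rpow_nonneg hJ _))).1 hS
  have h6' := pow_le_pow_left₀ (Real.rpow_nonneg hI _) h 6
  have eI : ((∫ x, ‖g x‖ ^ 6) ^ (6 : ℝ)⁻¹) ^ 6 = ∫ x, ‖g x‖ ^ 6 := by
    exact_mod_cast Real.rpow_inv_natCast_pow hI (n := 6) (by norm_num)
  have eJ : ((∫ x, ‖fderiv ℝ g x‖ ^ 2) ^ (2 : ℝ)⁻¹) ^ 2 = ∫ x, ‖fderiv ℝ g x‖ ^ 2 := by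
    exact_mod_cast Real.rpow_inv_natCast_pow hJ (n := 2) (by norm_num)
  have eK : ((∫ x, ‖fderiv ℝ g x‖ ^ 2) ^ (2 : ℝ)⁻¹) ^ 6 = (∫ x, ‖fderiv ℝ g x‖ ^ 2) ^ 3 := by
    rw [show 6 = 2 * 3 from rfl, pow_mul, eJ]
  rw [eI, mul_pow, eK] at h6'
  exact h6'

/-- **The `L⁴` interpolation bound, whole space**: for `g ∈ C¹` with `g, Dg ∈ L²`, `g ∈ L⁴` and
`∫‖g‖⁴ ≤ K³ (∫‖g‖²)^{1/2} (√∫‖Dg‖²)³` (`‖g‖₄ ≤ ‖g‖₂^{1/4}‖g‖₆^{3/4}` and Sobolev). [folklore] -/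
theorem memLp_four_and_integral_norm_pow_four_le {g : ℝ³ → F} (hg : ContDiff ℝ 1 g)
    (h2 : MemLp g 2 volume) (hD : MemLp (fderiv ℝ g) 2 volume) :
    MemLp g 4 volume ∧ ∫ x, ‖g x‖ ^ 4 ≤
      sobolevSix F ^ 3 * Real.sqrt (∫ x, ‖g x‖ ^ 2) * Real.sqrt (∫ x, ‖fderiv ℝ g x‖ ^ 2) ^ 3 := by
  obtain ⟨h6, hI6⟩ := memLp_six_and_integral_norm_pow_six_le hg h2 hD
  have hK : 0 ≤ sobolevSix F := NNReal.coe_nonneg _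
  have h4 : MemLp g 4 volume := by
    have hi2 : Integrable (fun x => ‖g x‖ ^ 2) := by
      have := (memLp_two_iff_integrable_sq_norm h2.1).1 h2; simpa using this
    have hi6 : Integrable (fun x => ‖g x‖ ^ 6) := by
      have := (integrable_norm_rpow_iff h6.1 (by norm_num) (by norm_num)).2 h6
      simpa [Real.rpow_natCast] using this
    have hi4 : Integrable (fun x => ‖g x‖ ^ 4) := by
      refine (hi2.add hi6).mono' ((hg.continuous.norm.pow 4).aestronglyMeasurable)
        (Eventually.of_forall fun x => ?_)
      simp only [Real.norm_eq_abs, abs_pow, abs_norm, Pi.add_apply]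
      have h0 := norm_nonneg (g x)
      nlinarith [sq_nonneg (‖g x‖ ^ 2 - 1), sq_nonneg (‖g x‖), pow_nonneg h0 4, pow_nonneg h0 2]
    have := (integrable_norm_rpow_iff (hg.continuous.aestronglyMeasurable) (by norm_num) (by norm_num)
      (p := (4 : ℝ≥0∞)) (μ := volume) (f := g)).1 (by simpa [Real.rpow_natCast] using hi4)
    exact this
  refine ⟨h4, ?_⟩
  have h := integral_norm_pow_four_le (μ := volume) h2 h6
  refine h.trans ?_
  have hsq : Real.sqrt (∫ x, ‖g x‖ ^ 6) ≤ sobolevSix F ^ 3 * Real.sqrt (∫ x, ‖fderiv ℝ g x‖ ^ 2) ^ 3 := by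
    have hJ : 0 ≤ ∫ x, ‖fderiv ℝ g x‖ ^ 2 := integral_nonneg fun _ => sq_nonneg _
    calc Real.sqrt (∫ x, ‖g x‖ ^ 6) ≤ Real.sqrt (sobolevSix F ^ 6 * (∫ x, ‖fderiv ℝ g x‖ ^ 2) ^ 3) :=
          Real.sqrt_le_sqrt hI6
      _ = sobolevSix F ^ 3 * Real.sqrt (∫ x, ‖fderiv ℝ g x‖ ^ 2) ^ 3 := by
          have hs : Real.sqrt (∫ x, ‖fderiv ℝ g x‖ ^ 2) ^ 2 = ∫ x, ‖fderiv ℝ g x‖ ^ 2 := Real.sq_sqrt hJ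
          have e : (sobolevSix F ^ 3 * Real.sqrt (∫ x, ‖fderiv ℝ g x‖ ^ 2) ^ 3) ^ 2 =
              sobolevSix F ^ 6 * (∫ x, ‖fderiv ℝ g x‖ ^ 2) ^ 3 := by
            rw [show (sobolevSix F ^ 3 * Real.sqrt (∫ x, ‖fderiv ℝ g x‖ ^ 2) ^ 3) ^ 2 =
              sobolevSix F ^ 6 * (Real.sqrt (∫ x, ‖fderiv ℝ g x‖ ^ 2) ^ 2) ^ 3 by ring, hs]
          rw [← e]
          exact Real.sqrt_sq (by positivity)
  calc Real.sqrt (∫ x, ‖g x‖ ^ 2) * Real.sqrt (∫ x, ‖g x‖ ^ 6)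
      ≤ Real.sqrt (∫ x, ‖g x‖ ^ 2) * (sobolevSix F ^ 3 * Real.sqrt (∫ x, ‖fderiv ℝ g x‖ ^ 2) ^ 3) :=
        mul_le_mul_of_nonneg_left hsq (Real.sqrt_nonneg _)
    _ = _ := by ring

end Sobolev

section DivCurl

/-- The standard orthonormal basis of `ℝ³`. -/
local notation "𝐞" => EuclideanSpace.basisFun (Fin 3) ℝ

/-- From `∫⁻ S ≤ ∫⁻ T` (as `ofReal`) with `S ≥ 0` continuous and `T ≥ 0` integrable:
`S` is integrable and `∫ S ≤ ∫ T`. [folklore] -/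
theorem integrable_and_integral_le_of_lintegral_ofReal_le {S T : ℝ³ → ℝ} (hSc : Continuous S)
    (hS0 : ∀ x, 0 ≤ S x) (hT0 : ∀ x, 0 ≤ T x) (hT : Integrable T)
    (h : ∫⁻ x, ENNReal.ofReal (S x) ≤ ∫⁻ x, ENNReal.ofReal (T x)) :
    Integrable S ∧ ∫ x, S x ≤ ∫ x, T x := by
  have hTe : ∫⁻ x, ENNReal.ofReal (T x) = ENNReal.ofReal (∫ x, T x) :=
    (ofReal_integral_eq_lintegral_ofReal hT (Eventually.of_forall hT0)).symm
  have hfin : ∫⁻ x, ENNReal.ofReal (S x) < ⊤ := lt_of_le_of_lt h (by rw [hTe]; exact ENNReal.ofReal_lt_top)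
  have hSi : Integrable S := by
    refine ⟨hSc.aestronglyMeasurable, ?_⟩
    rw [hasFiniteIntegral_iff_norm]
    refine lt_of_le_of_lt (le_of_eq (lintegral_congr fun x => ?_)) hfin
    rw [Real.norm_eq_abs, abs_of_nonneg (hS0 x)]
  refine ⟨hSi, ?_⟩
  have hSe : ∫⁻ x, ENNReal.ofReal (S x) = ENNReal.ofReal (∫ x, S x) :=
    (ofReal_integral_eq_lintegral_ofReal hSi (Eventually.of_forall hS0)).symm
  rw [hSe, hTe] at h
  exact (ENNReal.ofReal_le_ofReal_iff (integral_nonneg hT0)).1 h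

/-- `½ Σᵢⱼ (⟪L eᵢ, eⱼ⟫ − ⟪L eⱼ, eᵢ⟫)² = |curl v|²` for `L = Dv(x)` on `ℝ³`. [folklore] -/
theorem half_sum_sq_eq_norm_curl_sq (v : ℝ³ → ℝ³) (x : ℝ³) :
    (1 / 2) * ∑ i, ∑ j, (⟪fderiv ℝ v x (𝐞 i), 𝐞 j⟫ - ⟪fderiv ℝ v x (𝐞 j), 𝐞 i⟫) ^ 2 = ‖curl v x‖ ^ 2 := by
  have h1 := frobeniusNormSq_eq_trace_comp_add_half_sum 𝐞 (fderiv ℝ v x)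
  have h2 := frobeniusNormSq_fderiv_eq_sq_norm_curl_add_trace v x
  linarith

/-- **`div`–`curl`, first order, for `U ∈ L⁴`**: for a divergence-free `U ∈ C²(ℝ³; ℝ³) ∩ L⁴` with
`curl U ∈ L²`, `|DU|_F²` is integrable and `∫ |DU|²_F ≤ ∫ |curl U|²`. [folklore] -/
theorem integral_frobeniusNormSq_fderiv_le {U : ℝ³ → ℝ³} (hU : ContDiff ℝ 2 U)
    (hdiv : VectorCalculus.IsDivFree U) (h4 : MemLp U 4 volume)
    (hΩ : Integrable fun x => ‖curl U x‖ ^ 2) :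
    Integrable (fun x => frobeniusNormSq (fderiv ℝ U x)) ∧
      ∫ x, frobeniusNormSq (fderiv ℝ U x) ≤ ∫ x, ‖curl U x‖ ^ 2 := by
  have hE : finrank ℝ ℝ³ = 3 := by simp
  have h := lintegral_frobeniusNormSq_fderiv_le_of_memLp_two_add_four hE 𝐞 hU hdiv
    (h := 0) (k := U) (by simp) MemLp.zero h4
  simp_rw [half_sum_sq_eq_norm_curl_sq] at h
  have hU1 : ContDiff ℝ 1 U := hU.of_le (by norm_cast)
  have hSc : Continuous fun x => frobeniusNormSq (fderiv ℝ U x) := by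
    simp only [frobeniusNormSq]
    exact continuous_finsetSum _ fun i _ => ((hU1.continuous_fderiv one_ne_zero).clm_apply continuous_const).norm.pow 2
  exact integrable_and_integral_le_of_lintegral_ofReal_le hSc (fun x => frobeniusNormSq_nonneg _)
    (fun x => sq_nonneg _) hΩ h

/-- `∫⁻ ‖f‖ₑ² < ∞` for `‖f‖²` integrable. [folklore] -/
theorem lintegral_enorm_sq_lt_top_of_integrable {F : Type*} [NormedAddCommGroup F] {f : ℝ³ → F}
    (hi : Integrable fun x => ‖f x‖ ^ 2) : ∫⁻ x, ‖f x‖ₑ ^ 2 < ⊤ := by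
  have h := hi.2
  rw [hasFiniteIntegral_iff_enorm] at h
  refine lt_of_le_of_lt (le_of_eq (lintegral_congr fun x => ?_)) h
  rw [Real.enorm_eq_ofReal (sq_nonneg _), ← ofReal_norm, ENNReal.ofReal_pow (norm_nonneg _)]

/-- `curl U ∈ C²` for `U ∈ C³`. [folklore] -/
theorem contDiff_two_curl {U : ℝ³ → ℝ³} (hU : ContDiff ℝ 3 U) : ContDiff ℝ 2 (curl U) := by
  rw [curl_eq_curlCLM_comp]
  exact curlCLM.contDiff.comp (hU.fderiv_right (m := 2) (by norm_cast))

/-- **`div`–`curl`, second order**: for a divergence-free `U ∈ C³` with `DU ∈ L²` and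
`D(curl U) ∈ L²`, each column `vₖ = ∂ₖU` satisfies `∫ |Dvₖ|²_F ≤ ∫ |∂ₖ curl U|²`. [folklore] -/
theorem integral_frobeniusNormSq_fderiv_column_le {U : ℝ³ → ℝ³} (hU : ContDiff ℝ 3 U)
    (hdiv : VectorCalculus.IsDivFree U) (hD : Integrable fun x => ‖fderiv ℝ U x‖ ^ 2)
    (hDΩ : Integrable fun x => ‖fderiv ℝ (curl U) x‖ ^ 2) (k : Fin 3) :
    Integrable (fun x => frobeniusNormSq (fderiv ℝ (fun y => fderiv ℝ U y (𝐞 k)) x)) ∧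
      ∫ x, frobeniusNormSq (fderiv ℝ (fun y => fderiv ℝ U y (𝐞 k)) x) ≤
        ∫ x, ‖fderiv ℝ (curl U) x (𝐞 k)‖ ^ 2 := by
  have hU2 : ContDiff ℝ 2 U := hU.of_le (by norm_cast)
  have hv2 : ContDiff ℝ 2 (fun y => fderiv ℝ U y (𝐞 k)) :=
    (hU.fderiv_right (m := 2) (by norm_cast)).clm_apply contDiff_const
  have hvdiv : VectorCalculus.IsDivFree (fun y => fderiv ℝ U y (𝐞 k)) := hdiv.fderiv_apply hU2 (𝐞 k)
  have he : ‖(𝐞 k : ℝ³)‖ = 1 := (EuclideanSpace.basisFun (Fin 3) ℝ).orthonormal.1 k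
  have hvi : Integrable fun x => ‖fderiv ℝ U x (𝐞 k)‖ ^ 2 := by
    refine hD.mono' (((hU2.continuous_fderiv (by norm_num)).clm_apply continuous_const).norm.pow 2).aestronglyMeasurable
      (Eventually.of_forall fun x => ?_)
    simp only [Real.norm_eq_abs, abs_pow, abs_norm]
    have h1 : ‖fderiv ℝ U x (𝐞 k)‖ ≤ ‖fderiv ℝ U x‖ := by
      simpa [he] using (fderiv ℝ U x).le_opNorm (𝐞 k)
    exact pow_le_pow_left₀ (norm_nonneg _) h1 2
  have h := lintegral_frobeniusNormSq_fderiv_le_lintegral_sq_norm_curl hv2 hvdiv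
    (lintegral_enorm_sq_lt_top_of_integrable hvi)
  have hcurl : ∀ x, curl (fun y => fderiv ℝ U y (𝐞 k)) x = fderiv ℝ (curl U) x (𝐞 k) := fun x =>
    curl_fderiv_apply hU2 x (𝐞 k)
  simp_rw [hcurl] at h
  have hT : Integrable fun x => ‖fderiv ℝ (curl U) x (𝐞 k)‖ ^ 2 := by
    have hc := contDiff_two_curl hU
    refine hDΩ.mono' (((hc.continuous_fderiv (by norm_num)).clm_apply continuous_const).norm.pow 2).aestronglyMeasurable
      (Eventually.of_forall fun x => ?_)
    simp only [Real.norm_eq_abs, abs_pow, abs_norm]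
    have h1 : ‖fderiv ℝ (curl U) x (𝐞 k)‖ ≤ ‖fderiv ℝ (curl U) x‖ := by
      simpa [he] using (fderiv ℝ (curl U) x).le_opNorm (𝐞 k)
    exact pow_le_pow_left₀ (norm_nonneg _) h1 2
  have h' : ∫⁻ x, ENNReal.ofReal (frobeniusNormSq (fderiv ℝ (fun y => fderiv ℝ U y (𝐞 k)) x)) ≤
      ∫⁻ x, ENNReal.ofReal (‖fderiv ℝ (curl U) x (𝐞 k)‖ ^ 2) := by
    refine h.trans (le_of_eq (lintegral_congr fun x => ?_))
    rw [← ofReal_norm, ENNReal.ofReal_pow (norm_nonneg _)]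
  have hSc : Continuous fun x => frobeniusNormSq (fderiv ℝ (fun y => fderiv ℝ U y (𝐞 k)) x) := by
    simp only [frobeniusNormSq]
    exact continuous_finsetSum _ fun i _ =>
      (((hv2.continuous_fderiv (by norm_num)).clm_apply continuous_const).norm.pow 2)
  exact integrable_and_integral_le_of_lintegral_ofReal_le hSc (fun x => frobeniusNormSq_nonneg _)
    (fun x => sq_nonneg _) hT h'

/-- The derivative of the column `vₖ = ∂ₖU` is `D²U(·)(·, eₖ)`; its norm is at most... we only
need: `‖D vₖ(x)‖² ≤ |D vₖ(x)|²_F`. Columns and the full gradient: `‖DU x‖² ≤ |DU x|²_F = Σₖ ‖vₖ x‖²`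
and `‖DU x‖⁴ ≤ 3 Σₖ ‖vₖ x‖⁴`. [folklore] -/
theorem norm_fderiv_pow_four_le_three_mul_sum (U : ℝ³ → ℝ³) (x : ℝ³) :
    ‖fderiv ℝ U x‖ ^ 4 ≤ 3 * ∑ k, ‖fderiv ℝ U x (𝐞 k)‖ ^ 4 := by
  have h1 : ‖fderiv ℝ U x‖ ^ 2 ≤ ∑ k, ‖fderiv ℝ U x (𝐞 k)‖ ^ 2 := by
    rw [← frobeniusNormSq_eq_sum 𝐞]; exact norm_sq_le_frobeniusNormSq _
  have h0 : 0 ≤ ‖fderiv ℝ U x‖ ^ 2 := sq_nonneg _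
  have h2 : ‖fderiv ℝ U x‖ ^ 4 ≤ (∑ k, ‖fderiv ℝ U x (𝐞 k)‖ ^ 2) ^ 2 := by
    rw [show (4 : ℕ) = 2 * 2 from rfl, pow_mul]; exact pow_le_pow_left₀ h0 h1 2
  refine h2.trans ?_
  simp only [Fin.sum_univ_three]
  nlinarith [sq_nonneg (‖fderiv ℝ U x (𝐞 0)‖ ^ 2 - ‖fderiv ℝ U x (𝐞 1)‖ ^ 2),
    sq_nonneg (‖fderiv ℝ U x (𝐞 1)‖ ^ 2 - ‖fderiv ℝ U x (𝐞 2)‖ ^ 2),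
    sq_nonneg (‖fderiv ℝ U x (𝐞 0)‖ ^ 2 - ‖fderiv ℝ U x (𝐞 2)‖ ^ 2)]

/-- **The `L²` and `L⁴` bounds for `DU` in terms of the vorticity** (div–curl at first and second
order + Sobolev): for a divergence-free `U ∈ C³ ∩ L⁴` with `Ω = curl U`, `Ω, DΩ ∈ L²`:
`∫‖DU‖² ≤ ∫|Ω|²` and `∫‖DU‖⁴ ≤ 9K³ (∫|Ω|²)^{1/2} (∫‖DΩ‖²)^{3/2}`. [folklore] -/
theorem integral_norm_fderiv_pow_four_le {U : ℝ³ → ℝ³} (hU : ContDiff ℝ 3 U)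
    (hdiv : VectorCalculus.IsDivFree U) (h4 : MemLp U 4 volume)
    (hΩ : Integrable fun x => ‖curl U x‖ ^ 2) (hDΩ : Integrable fun x => ‖fderiv ℝ (curl U) x‖ ^ 2) :
    Integrable (fun x => ‖fderiv ℝ U x‖ ^ 2) ∧ ∫ x, ‖fderiv ℝ U x‖ ^ 2 ≤ ∫ x, ‖curl U x‖ ^ 2 ∧
    Integrable (fun x => ‖fderiv ℝ U x‖ ^ 4) ∧
      ∫ x, ‖fderiv ℝ U x‖ ^ 4 ≤ 9 * sobolevSix ℝ³ ^ 3 * Real.sqrt (∫ x, ‖curl U x‖ ^ 2) *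
        Real.sqrt (∫ x, ‖fderiv ℝ (curl U) x‖ ^ 2) ^ 3 := by
  have hU2 : ContDiff ℝ 2 U := hU.of_le (by norm_cast)
  have hU1 : ContDiff ℝ 1 U := hU.of_le (by norm_cast)
  have hDc : Continuous (fderiv ℝ U) := hU1.continuous_fderiv one_ne_zero
  obtain ⟨hFi, hF⟩ := integral_frobeniusNormSq_fderiv_le hU2 hdiv h4 hΩ
  -- `‖DU‖² ≤ |DU|²_F`
  have hDi : Integrable fun x => ‖fderiv ℝ U x‖ ^ 2 :=
    hFi.mono' (hDc.norm.pow 2).aestronglyMeasurable (Eventually.of_forall fun x => by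
      simp only [Real.norm_eq_abs, abs_pow, abs_norm]; exact norm_sq_le_frobeniusNormSq _)
  have hDle : ∫ x, ‖fderiv ℝ U x‖ ^ 2 ≤ ∫ x, ‖curl U x‖ ^ 2 :=
    (integral_mono hDi hFi fun x => norm_sq_le_frobeniusNormSq _).trans hF
  refine ⟨hDi, hDle, ?_⟩
  -- the columns
  set a := ∫ x, ‖curl U x‖ ^ 2 with ha
  set b := ∫ x, ‖fderiv ℝ (curl U) x‖ ^ 2 with hb
  have hcol : ∀ k : Fin 3, Integrable (fun x => ‖fderiv ℝ U x (𝐞 k)‖ ^ 4) ∧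
      ∫ x, ‖fderiv ℝ U x (𝐞 k)‖ ^ 4 ≤ sobolevSix ℝ³ ^ 3 * Real.sqrt a * Real.sqrt b ^ 3 := by
    intro k
    have hvc : ContDiff ℝ 1 (fun y => fderiv ℝ U y (𝐞 k)) :=
      ((hU.fderiv_right (m := 2) (by norm_cast)).clm_apply contDiff_const).of_le (by norm_cast)
    have hv2c : ContDiff ℝ 2 (fun y => fderiv ℝ U y (𝐞 k)) :=
      (hU.fderiv_right (m := 2) (by norm_cast)).clm_apply contDiff_const
    have hvk_le : ∀ x, ‖fderiv ℝ U x (𝐞 k)‖ ^ 2 ≤ frobeniusNormSq (fderiv ℝ U x) := fun x => by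
      rw [frobeniusNormSq_eq_sum 𝐞]
      exact Finset.single_le_sum (f := fun j => ‖fderiv ℝ U x (𝐞 j)‖ ^ 2) (fun _ _ => sq_nonneg _)
        (Finset.mem_univ k)
    have hvi : Integrable fun x => ‖fderiv ℝ U x (𝐞 k)‖ ^ 2 :=
      hFi.mono' ((hDc.clm_apply continuous_const).norm.pow 2).aestronglyMeasurable
        (Eventually.of_forall fun x => by simp only [Real.norm_eq_abs, abs_pow, abs_norm]; exact hvk_le x)
    have hv2 : MemLp (fun y => fderiv ℝ U y (𝐞 k)) 2 volume :=
      (memLp_two_iff_integrable_sq_norm (hDc.clm_apply continuous_const).aestronglyMeasurable).2 hvi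
    obtain ⟨hGi, hG⟩ := integral_frobeniusNormSq_fderiv_column_le hU hdiv hDi hDΩ k
    have hDvc : Continuous (fderiv ℝ (fun y => fderiv ℝ U y (𝐞 k))) := hvc.continuous_fderiv one_ne_zero
    have hDvi : Integrable fun x => ‖fderiv ℝ (fun y => fderiv ℝ U y (𝐞 k)) x‖ ^ 2 :=
      hGi.mono' (hDvc.norm.pow 2).aestronglyMeasurable (Eventually.of_forall fun x => by
        simp only [Real.norm_eq_abs, abs_pow, abs_norm]; exact norm_sq_le_frobeniusNormSq _)
    have hDv2 : MemLp (fderiv ℝ (fun y => fderiv ℝ U y (𝐞 k))) 2 volume :=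
      (memLp_two_iff_integrable_sq_norm hDvc.aestronglyMeasurable).2 hDvi
    obtain ⟨-, h4k⟩ := memLp_four_and_integral_norm_pow_four_le hvc hv2 hDv2
    have hi4 : Integrable fun x => ‖fderiv ℝ U x (𝐞 k)‖ ^ 4 := by
      obtain ⟨hm4, -⟩ := memLp_four_and_integral_norm_pow_four_le hvc hv2 hDv2
      have := (integrable_norm_rpow_iff hm4.1 (by norm_num) (by norm_num)).2 hm4
      simpa [Real.rpow_natCast] using this
    refine ⟨hi4, h4k.trans ?_⟩
    have he : ‖(𝐞 k : ℝ³)‖ = 1 := (EuclideanSpace.basisFun (Fin 3) ℝ).orthonormal.1 k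
    have i1 : ∫ x, ‖fderiv ℝ U x (𝐞 k)‖ ^ 2 ≤ a :=
      ((integral_mono hvi hFi hvk_le).trans hF)
    have i2 : ∫ x, ‖fderiv ℝ (fun y => fderiv ℝ U y (𝐞 k)) x‖ ^ 2 ≤ b := by
      refine ((integral_mono hDvi hGi fun x => norm_sq_le_frobeniusNormSq _).trans hG).trans ?_
      refine integral_mono ?_ hDΩ fun x => ?_
      · exact hDΩ.mono' ((((contDiff_two_curl hU).continuous_fderiv (by norm_num)).clm_apply
          continuous_const).norm.pow 2).aestronglyMeasurable (Eventually.of_forall fun x => by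
            simp only [Real.norm_eq_abs, abs_pow, abs_norm]
            have h1 : ‖fderiv ℝ (curl U) x (𝐞 k)‖ ≤ ‖fderiv ℝ (curl U) x‖ := by
              simpa [he] using (fderiv ℝ (curl U) x).le_opNorm (𝐞 k)
            exact pow_le_pow_left₀ (norm_nonneg _) h1 2)
      · have h1 : ‖fderiv ℝ (curl U) x (𝐞 k)‖ ≤ ‖fderiv ℝ (curl U) x‖ := by
          simpa [he] using (fderiv ℝ (curl U) x).le_opNorm (𝐞 k)
        exact pow_le_pow_left₀ (norm_nonneg _) h1 2
    have hK : 0 ≤ sobolevSix ℝ³ := NNReal.coe_nonneg _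
    have s1 := Real.sqrt_le_sqrt i1
    have s2 := Real.sqrt_le_sqrt i2
    have s3 : Real.sqrt (∫ x, ‖fderiv ℝ (fun y => fderiv ℝ U y (𝐞 k)) x‖ ^ 2) ^ 3 ≤ Real.sqrt b ^ 3 :=
      pow_le_pow_left₀ (Real.sqrt_nonneg _) s2 3
    exact mul_le_mul (mul_le_mul_of_nonneg_left s1 (pow_nonneg hK 3)) s3 (pow_nonneg (Real.sqrt_nonneg _) 3)
      (mul_nonneg (pow_nonneg hK 3) (Real.sqrt_nonneg _))
  -- assemble
  have hsum : Integrable fun x => 3 * ∑ k, ‖fderiv ℝ U x (𝐞 k)‖ ^ 4 :=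
    (integrable_finsetSum _ fun k _ => (hcol k).1).const_mul 3
  have h4i : Integrable fun x => ‖fderiv ℝ U x‖ ^ 4 :=
    hsum.mono' (hDc.norm.pow 4).aestronglyMeasurable (Eventually.of_forall fun x => by
      simp only [Real.norm_eq_abs, abs_pow, abs_norm]; exact norm_fderiv_pow_four_le_three_mul_sum U x)
  refine ⟨h4i, ?_⟩
  calc ∫ x, ‖fderiv ℝ U x‖ ^ 4 ≤ ∫ x, 3 * ∑ k, ‖fderiv ℝ U x (𝐞 k)‖ ^ 4 :=
        integral_mono h4i hsum fun x => norm_fderiv_pow_four_le_three_mul_sum U x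
    _ = 3 * ∑ k, ∫ x, ‖fderiv ℝ U x (𝐞 k)‖ ^ 4 := by
        rw [integral_const_mul, integral_finsetSum _ fun k _ => (hcol k).1]
    _ ≤ 3 * ∑ _k : Fin 3, sobolevSix ℝ³ ^ 3 * Real.sqrt a * Real.sqrt b ^ 3 := by
        refine mul_le_mul_of_nonneg_left (Finset.sum_le_sum fun k _ => (hcol k).2) (by norm_num)
    _ = 9 * sobolevSix ℝ³ ^ 3 * Real.sqrt a * Real.sqrt b ^ 3 := by
        simp only [Finset.sum_const, Finset.card_univ, Fintype.card_fin, nsmul_eq_mul]; ring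

/-- MemLp 2 of a continuous real function with integrable square. [folklore] -/
theorem memLp_two_of_integrable_sq {μ : Measure ℝ³} {f : ℝ³ → ℝ} (hf : Continuous f)
    (hi : Integrable (fun x => f x ^ 2) μ) : MemLp f 2 μ := by
  refine (memLp_two_iff_integrable_sq hf.aestronglyMeasurable).2 ?_
  simpa using hi

/-- `√(√a (√b)³) ≤ a + b` for `a, b ≥ 0`. [folklore] -/
theorem sqrt_sqrt_mul_sqrt_pow_three_le {a b : ℝ} (ha : 0 ≤ a) (hb : 0 ≤ b) :
    Real.sqrt (Real.sqrt a * Real.sqrt b ^ 3) ≤ a + b := by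
  rw [Real.sqrt_le_left (by positivity)]
  set s := Real.sqrt a with hs
  set t := Real.sqrt b with ht
  have hs2 : s ^ 2 = a := Real.sq_sqrt ha
  have ht2 : t ^ 2 = b := Real.sq_sqrt hb
  have hs0 : 0 ≤ s := Real.sqrt_nonneg _
  have ht0 : 0 ≤ t := Real.sqrt_nonneg _
  rw [← hs2, ← ht2]
  nlinarith [sq_nonneg (s - t), sq_nonneg (s + t), mul_nonneg hs0 ht0, sq_nonneg (s * t), sq_nonneg (s^2 - t^2),
    mul_nonneg (mul_nonneg hs0 ht0) (sq_nonneg (s - t))]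

/-- The universal constant `C_Ω = √3 K^{3/2}` of the vortex-stretching estimate (3.4)
(`K` the Sobolev constant of `Ḣ¹(ℝ³; ℝ³) ⊂ L⁶`). [cite: PineauVicol2026, Proposition 3.1 (C_Ω)] -/
def vortexConst : ℝ := Real.sqrt 3 * Real.sqrt (sobolevSix ℝ³) ^ 3

/-- `C_Ω ≥ 0`. [folklore] -/
theorem vortexConst_nonneg : 0 ≤ vortexConst := by unfold vortexConst; positivity

/-- **The vortex-stretching estimate (Pineau–Vicol (3.4)).** For a divergence-free
`U ∈ C³(ℝ³) ∩ L⁴` with `Ω = curl U`, `Ω, DΩ ∈ L²` and `‖DU‖ ≤ 1/8` outside `B(0, R̄)`: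
`∫ Ω·(DU)Ω ≤ ⅛‖Ω‖₂² + C_Ω ‖Ω‖_{L²(B_R̄)} (‖Ω‖₂² + ‖DΩ‖₂²)` with a universal `C_Ω`
(split at `|y| = R̄`, Cauchy–Schwarz, `‖Ω‖₄‖DU‖₄ ≲ ‖Ω‖₂^{1/2}‖DΩ‖₂^{3/2}` by the `div`–`curl`
estimates and Gagliardo–Nirenberg–Sobolev — in place of the Calderón–Zygmund bound
`‖∇U‖₄ ≤ C′‖Ω‖₄` of the source — and Young). [cite: PineauVicol2026, Proposition 3.1, (3.4)] -/
theorem integral_inner_curl_fderiv_curl_le {U : ℝ³ → ℝ³} (hU : ContDiff ℝ 3 U)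
    (hdiv : VectorCalculus.IsDivFree U) (h4 : MemLp U 4 volume)
    (hΩ : Integrable fun x => ‖curl U x‖ ^ 2) (hDΩ : Integrable fun x => ‖fderiv ℝ (curl U) x‖ ^ 2)
    {R : ℝ} (hsmall : ∀ x, R ≤ ‖x‖ → ‖fderiv ℝ U x‖ ≤ 1 / 8) :
    Integrable (fun x => ⟪curl U x, fderiv ℝ U x (curl U x)⟫) ∧
      ∫ x, ⟪curl U x, fderiv ℝ U x (curl U x)⟫ ≤ (1 / 8) * (∫ x, ‖curl U x‖ ^ 2) +
        vortexConst * Real.sqrt (∫ x in Metric.ball 0 R, ‖curl U x‖ ^ 2) *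
          ((∫ x, ‖curl U x‖ ^ 2) + ∫ x, ‖fderiv ℝ (curl U) x‖ ^ 2) := by
  have hU1 : ContDiff ℝ 1 U := hU.of_le (by norm_cast)
  have hDc : Continuous (fderiv ℝ U) := hU1.continuous_fderiv one_ne_zero
  have hΩc2 := contDiff_two_curl hU
  have hΩc1 : ContDiff ℝ 1 (curl U) := hΩc2.of_le one_le_two
  have hΩc : Continuous (curl U) := hΩc2.continuous
  have hDΩc : Continuous (fderiv ℝ (curl U)) := hΩc1.continuous_fderiv one_ne_zero
  obtain ⟨hDi, hDle, hD4i, hD4⟩ := integral_norm_fderiv_pow_four_le hU hdiv h4 hΩ hDΩ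
  have hΩ2 : MemLp (curl U) 2 volume := (memLp_two_iff_integrable_sq_norm hΩc.aestronglyMeasurable).2 hΩ
  have hDΩ2 : MemLp (fderiv ℝ (curl U)) 2 volume :=
    (memLp_two_iff_integrable_sq_norm hDΩc.aestronglyMeasurable).2 hDΩ
  obtain ⟨hΩ4m, hΩ4⟩ := memLp_four_and_integral_norm_pow_four_le hΩc1 hΩ2 hDΩ2
  have hΩ4i : Integrable fun x => ‖curl U x‖ ^ 4 := by
    have := (integrable_norm_rpow_iff hΩ4m.1 (by norm_num) (by norm_num)).2 hΩ4m
    simpa [Real.rpow_natCast] using this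
  set a := ∫ x, ‖curl U x‖ ^ 2 with ha
  set b := ∫ x, ‖fderiv ℝ (curl U) x‖ ^ 2 with hb
  have ha0 : 0 ≤ a := integral_nonneg fun _ => sq_nonneg _
  have hb0 : 0 ≤ b := integral_nonneg fun _ => sq_nonneg _
  have hK : 0 ≤ sobolevSix ℝ³ := NNReal.coe_nonneg _
  set P₁ : ℝ := sobolevSix ℝ³ ^ 3 * Real.sqrt a * Real.sqrt b ^ 3 with hP₁
  have hP₁0 : 0 ≤ P₁ := by positivity
  clear_value a b P₁
  -- the integrands
  set f : ℝ³ → ℝ := fun x => ⟪curl U x, fderiv ℝ U x (curl U x)⟫ with hf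
  set g : ℝ³ → ℝ := fun x => ‖curl U x‖ ^ 2 * ‖fderiv ℝ U x‖ with hg
  have hfc : Continuous f := hΩc.inner (hDc.clm_apply hΩc)
  have hgc : Continuous g := (hΩc.norm.pow 2).mul hDc.norm
  have hfg : ∀ x, |f x| ≤ g x := fun x => by
    calc |f x| ≤ ‖curl U x‖ * ‖fderiv ℝ U x (curl U x)‖ := abs_real_inner_le_norm _ _
      _ ≤ ‖curl U x‖ * (‖fderiv ℝ U x‖ * ‖curl U x‖) :=
          mul_le_mul_of_nonneg_left ((fderiv ℝ U x).le_opNorm _) (norm_nonneg _)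
      _ = g x := by rw [hg]; ring
  have hg_le : ∀ x, g x ≤ (1 / 2) * (‖curl U x‖ ^ 4 + ‖fderiv ℝ U x‖ ^ 2) := fun x => by
    rw [hg]; nlinarith [sq_nonneg (‖curl U x‖ ^ 2 - ‖fderiv ℝ U x‖)]
  have hg0 : ∀ x, 0 ≤ g x := fun x => by rw [hg]; positivity
  have hgi : Integrable g :=
    ((hΩ4i.add hDi).const_mul (1 / 2)).mono' hgc.aestronglyMeasurable (Eventually.of_forall fun x => by
      rw [Real.norm_eq_abs, abs_of_nonneg (hg0 x)]; exact hg_le x)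
  have hfi : Integrable f := hgi.mono' hfc.aestronglyMeasurable (Eventually.of_forall fun x => by
    rw [Real.norm_eq_abs]; exact hfg x)
  refine ⟨hfi, ?_⟩
  -- split at `|x| = R`
  set B : Set ℝ³ := Metric.ball 0 R with hB
  have hsplit : ∀ x, f x ≤ (1 / 8) * ‖curl U x‖ ^ 2 + B.indicator g x := by
    intro x
    by_cases hx : x ∈ B
    · rw [Set.indicator_of_mem hx]
      have := (le_abs_self _).trans (hfg x)
      nlinarith [sq_nonneg ‖curl U x‖]
    · rw [Set.indicator_of_notMem hx, add_zero]
      have hxR : R ≤ ‖x‖ := by simpa [hB, Metric.mem_ball, dist_zero_right] using hx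
      calc f x ≤ |f x| := le_abs_self _
        _ ≤ g x := hfg x
        _ = ‖curl U x‖ ^ 2 * ‖fderiv ℝ U x‖ := rfl
        _ ≤ ‖curl U x‖ ^ 2 * (1 / 8) := mul_le_mul_of_nonneg_left (hsmall x hxR) (sq_nonneg _)
        _ = (1 / 8) * ‖curl U x‖ ^ 2 := by ring
  have hBi : Integrable (B.indicator g) := hgi.indicator measurableSet_ball
  have step1 : ∫ x, f x ≤ (1 / 8) * a + ∫ x in B, g x := by
    calc ∫ x, f x ≤ ∫ x, ((1 / 8) * ‖curl U x‖ ^ 2 + B.indicator g x) :=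
          integral_mono hfi ((hΩ.const_mul _).add hBi) hsplit
      _ = (1 / 8) * a + ∫ x in B, g x := by
          rw [integral_add (hΩ.const_mul _) hBi, integral_const_mul, integral_indicator measurableSet_ball, ha]
  -- Cauchy–Schwarz on the ball
  have step2 : ∫ x in B, g x ≤ Real.sqrt (∫ x in B, ‖curl U x‖ ^ 2) *
      Real.sqrt (∫ x, ‖curl U x‖ ^ 2 * ‖fderiv ℝ U x‖ ^ 2) := by
    have hprod_i : Integrable fun x => ‖curl U x‖ ^ 2 * ‖fderiv ℝ U x‖ ^ 2 := by
      refine ((hΩ4i.add hD4i).const_mul (1 / 2)).mono' ((hΩc.norm.pow 2).mul (hDc.norm.pow 2)).aestronglyMeasurable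
        (Eventually.of_forall fun x => ?_)
      rw [Real.norm_eq_abs, abs_of_nonneg (by positivity)]
      simp only [Pi.add_apply]
      nlinarith [sq_nonneg (‖curl U x‖ ^ 2 - ‖fderiv ℝ U x‖ ^ 2)]
    have m1 : MemLp (fun x => ‖curl U x‖) 2 (volume.restrict B) :=
      memLp_two_of_integrable_sq hΩc.norm hΩ.restrict
    have m2 : MemLp (fun x => ‖curl U x‖ * ‖fderiv ℝ U x‖) 2 (volume.restrict B) := by
      refine memLp_two_of_integrable_sq (hΩc.norm.mul hDc.norm) ?_
      have : (fun x => (‖curl U x‖ * ‖fderiv ℝ U x‖) ^ 2) = fun x => ‖curl U x‖ ^ 2 * ‖fderiv ℝ U x‖ ^ 2 := by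
        funext x; ring
      rw [this]; exact hprod_i.restrict
    have h := integral_mul_le_sqrt_mul_sqrt_of_memLp m1 m2
    have e1 : ∫ x in B, g x = ∫ x in B, ‖curl U x‖ * (‖curl U x‖ * ‖fderiv ℝ U x‖) := by
      congr 1; funext x; rw [hg]; ring
    rw [e1]
    refine h.trans (mul_le_mul_of_nonneg_left ?_ (Real.sqrt_nonneg _))
    apply Real.sqrt_le_sqrt
    have e2 : (fun x => (‖curl U x‖ * ‖fderiv ℝ U x‖) ^ 2) = fun x => ‖curl U x‖ ^ 2 * ‖fderiv ℝ U x‖ ^ 2 := by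
      funext x; ring
    rw [e2]
    exact setIntegral_le_integral hprod_i (Eventually.of_forall fun x => by positivity)
  -- Cauchy–Schwarz for the quartic term and the `L⁴` bounds
  have step3 : ∫ x, ‖curl U x‖ ^ 2 * ‖fderiv ℝ U x‖ ^ 2 ≤ 3 * P₁ := by
    have m1 : MemLp (fun x => ‖curl U x‖ ^ 2) 2 volume := by
      refine memLp_two_of_integrable_sq (hΩc.norm.pow 2) ?_
      have : (fun x => (‖curl U x‖ ^ 2) ^ 2) = fun x => ‖curl U x‖ ^ 4 := by funext x; ring
      rw [this]; exact hΩ4i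
    have m2 : MemLp (fun x => ‖fderiv ℝ U x‖ ^ 2) 2 volume := by
      refine memLp_two_of_integrable_sq (hDc.norm.pow 2) ?_
      have : (fun x => (‖fderiv ℝ U x‖ ^ 2) ^ 2) = fun x => ‖fderiv ℝ U x‖ ^ 4 := by funext x; ring
      rw [this]; exact hD4i
    have h := integral_mul_le_sqrt_mul_sqrt_of_memLp m1 m2
    have e1 : (fun x => (‖curl U x‖ ^ 2) ^ 2) = fun x => ‖curl U x‖ ^ 4 := by funext x; ring
    have e2 : (fun x => (‖fderiv ℝ U x‖ ^ 2) ^ 2) = fun x => ‖fderiv ℝ U x‖ ^ 4 := by funext x; ring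
    simp only [e1, e2] at h
    refine h.trans ?_
    have s1 : Real.sqrt (∫ x, ‖curl U x‖ ^ 4) ≤ Real.sqrt P₁ := Real.sqrt_le_sqrt (by simpa [hP₁] using hΩ4)
    have s2 : Real.sqrt (∫ x, ‖fderiv ℝ U x‖ ^ 4) ≤ Real.sqrt (9 * P₁) :=
      Real.sqrt_le_sqrt (by simp only [hP₁]; linarith [hD4])
    calc Real.sqrt (∫ x, ‖curl U x‖ ^ 4) * Real.sqrt (∫ x, ‖fderiv ℝ U x‖ ^ 4)
        ≤ Real.sqrt P₁ * Real.sqrt (9 * P₁) := mul_le_mul s1 s2 (Real.sqrt_nonneg _) (Real.sqrt_nonneg _)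
      _ = 3 * P₁ := by
          rw [Real.sqrt_mul' _ hP₁0, show (9 : ℝ) = 3 ^ 2 by norm_num, Real.sqrt_sq (by norm_num)]
          nlinarith [Real.mul_self_sqrt hP₁0]
  -- `√(3 P₁) ≤ C_Ω (a + b)`
  have step4 : Real.sqrt (∫ x, ‖curl U x‖ ^ 2 * ‖fderiv ℝ U x‖ ^ 2) ≤ vortexConst * (a + b) := by
    refine (Real.sqrt_le_sqrt step3).trans ?_
    rw [hP₁, show 3 * (sobolevSix ℝ³ ^ 3 * Real.sqrt a * Real.sqrt b ^ 3) =
      (3 * sobolevSix ℝ³ ^ 3) * (Real.sqrt a * Real.sqrt b ^ 3) by ring, Real.sqrt_mul (by positivity)]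
    have e : Real.sqrt (3 * sobolevSix ℝ³ ^ 3) = vortexConst := by
      rw [vortexConst, Real.sqrt_mul (by norm_num)]
      congr 1
      rw [show sobolevSix ℝ³ ^ 3 = (Real.sqrt (sobolevSix ℝ³) ^ 3) ^ 2 by
        rw [← pow_mul, show 3 * 2 = 2 * 3 from rfl, pow_mul, Real.sq_sqrt hK]]
      exact Real.sqrt_sq (by positivity)
    rw [e]
    exact mul_le_mul_of_nonneg_left (sqrt_sqrt_mul_sqrt_pow_three_le ha0 hb0) vortexConst_nonneg
  -- conclude
  have hsB : 0 ≤ Real.sqrt (∫ x in B, ‖curl U x‖ ^ 2) := Real.sqrt_nonneg _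
  calc ∫ x, f x ≤ (1 / 8) * a + ∫ x in B, g x := step1
    _ ≤ (1 / 8) * a + Real.sqrt (∫ x in B, ‖curl U x‖ ^ 2) * (vortexConst * (a + b)) :=
        add_le_add_right (step2.trans (mul_le_mul_of_nonneg_left step4 hsB)) _
    _ = (1 / 8) * a + vortexConst * Real.sqrt (∫ x in B, ‖curl U x‖ ^ 2) * (a + b) := by ring

end DivCurl

section IBP

variable {E : Type*} [NormedAddCommGroup E] [InnerProductSpace ℝ E] [FiniteDimensional ℝ E]
  [MeasurableSpace E] [BorelSpace E]

omit [FiniteDimensional ℝ E] [MeasurableSpace E] [BorelSpace E] in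
/-- `D(χ_R) = 0` off the closed annulus: for `2R < |x|`. [folklore] -/
theorem fderiv_cutoff_eq_zero_of_lt {R : ℝ} (hR : 0 < R) {x : E} (hx : 2 * R < ‖x‖) :
    fderiv ℝ (cutoff R) x = 0 := by
  have h : (cutoff (E := E) R) =ᶠ[𝓝 x] fun _ => 0 := by
    have ho : IsOpen {y : E | 2 * R < ‖y‖} := isOpen_lt continuous_const continuous_norm
    filter_upwards [ho.mem_nhds hx] with y hy
    exact cutoff_eq_zero hR (le_of_lt hy)
  rw [h.fderiv_eq]; simp

/-- **`∫ div F = 0` under a logarithmically weaker flux condition**: for a `C¹` field `F` with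
`div F` integrable and `‖F‖/(1 + |y|)` integrable (e.g. `|F| ≲ (1+|y|)^{1−d}` in dimension `d`,
which is not integrable itself): cut-offs `χ_R`, `∫ χ_R div F = −∫ ⟪F, ∇χ_R⟫`, and
`|⟪F, ∇χ_R⟫| ≤ 3C ‖F‖/(1+|y|)` on the support of `∇χ_R`, dominated convergence. [folklore] -/
theorem integral_divergence_eq_zero_of_integrable_div {F : E → E} (hF : ContDiff ℝ 1 F)
    (hi : Integrable fun y => ‖F y‖ / (1 + ‖y‖))
    (hd : Integrable (fun y => VectorCalculus.divergence F y)) :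
    ∫ y, VectorCalculus.divergence F y = 0 := by
  haveI : CompleteSpace E := FiniteDimensional.complete ℝ E
  obtain ⟨C, hC0, hC⟩ := exists_norm_fderiv_cutoff_le (E := E)
  -- the cut-off identities
  have hibp : ∀ n : ℕ, ∫ y, cutoff ((n : ℝ) + 1) y * VectorCalculus.divergence F y =
      -∫ y, ⟪F y, gradient (cutoff ((n : ℝ) + 1)) y⟫ := by
    intro n
    have h := integral_mul_divergence_add_eq_zero_left (contDiff_cutoff (n := 1) ((n : ℝ) + 1)) hF
      (hasCompactSupport_cutoff (R := (n : ℝ) + 1) (by positivity))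
    linarith
  -- pointwise bound `|⟪F, ∇χ_n⟫| ≤ 3C ‖F‖/(1+|y|)` and pointwise convergence to `0`
  have hpt : ∀ (n : ℕ) (y : E), |⟪F y, gradient (cutoff ((n : ℝ) + 1)) y⟫| ≤ 3 * C * (‖F y‖ / (1 + ‖y‖)) := by
    intro n y
    have hR : (0 : ℝ) < (n : ℝ) + 1 := by positivity
    by_cases hy : ‖y‖ ≤ 2 * ((n : ℝ) + 1)
    · calc |⟪F y, gradient (cutoff ((n : ℝ) + 1)) y⟫| ≤ ‖F y‖ * ‖gradient (cutoff ((n : ℝ) + 1)) y‖ :=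
            abs_real_inner_le_norm _ _
        _ ≤ ‖F y‖ * (C / ((n : ℝ) + 1)) := by
            refine mul_le_mul_of_nonneg_left ?_ (norm_nonneg _)
            rw [show ‖gradient (cutoff ((n : ℝ) + 1)) y‖ = ‖fderiv ℝ (cutoff ((n : ℝ) + 1)) y‖ by simp [gradient]]
            exact hC _ hR y
        _ ≤ 3 * C * (‖F y‖ / (1 + ‖y‖)) := by
            have h1y : 0 < 1 + ‖y‖ := by positivity
            rw [show ‖F y‖ * (C / ((n : ℝ) + 1)) = C * ‖F y‖ * (1 / ((n : ℝ) + 1)) by ring,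
              show 3 * C * (‖F y‖ / (1 + ‖y‖)) = C * ‖F y‖ * (3 / (1 + ‖y‖)) by ring]
            refine mul_le_mul_of_nonneg_left ?_ (mul_nonneg hC0 (norm_nonneg _))
            rw [div_le_div_iff₀ hR h1y]; linarith
    · push Not at hy
      rw [gradient, fderiv_cutoff_eq_zero_of_lt hR hy, map_zero, inner_zero_right, abs_zero]
      positivity
  have hlim : ∀ y : E, Tendsto (fun n : ℕ => ⟪F y, gradient (cutoff ((n : ℝ) + 1)) y⟫) atTop (𝓝 0) := by
    intro y
    have hev : ∀ᶠ n : ℕ in atTop, ⟪F y, gradient (cutoff ((n : ℝ) + 1)) y⟫ = 0 := by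
      refine (eventually_gt_atTop ⌈‖y‖⌉₊).mono fun n hn => ?_
      have hyn : ‖y‖ < (n : ℝ) + 1 := by
        have := Nat.le_ceil ‖y‖
        have : (⌈‖y‖⌉₊ : ℝ) < n := by exact_mod_cast hn
        linarith
      have h : (cutoff (E := E) ((n : ℝ) + 1)) =ᶠ[𝓝 y] fun _ => 1 := by
        have ho : IsOpen {z : E | ‖z‖ < (n : ℝ) + 1} := isOpen_lt continuous_norm continuous_const
        filter_upwards [ho.mem_nhds hyn] with z hz
        exact cutoff_eq_one (by positivity) hz.le
      rw [gradient, h.fderiv_eq]; simp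
    exact tendsto_const_nhds.congr' (hev.mono fun n hn => hn.symm)
  have h1 : Tendsto (fun n : ℕ => -∫ y, ⟪F y, gradient (cutoff ((n : ℝ) + 1)) y⟫) atTop (𝓝 0) := by
    rw [← neg_zero]
    refine Tendsto.neg ?_
    have h := tendsto_integral_of_dominated_convergence (μ := (volume : Measure E))
      (F := fun (n : ℕ) (y : E) => ⟪F y, gradient (cutoff ((n : ℝ) + 1)) y⟫) (f := fun _ => (0 : ℝ))
      (fun y => 3 * C * (‖F y‖ / (1 + ‖y‖)))
      (fun n => (hF.continuous.inner (continuous_gradient_of_contDiff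
        (contDiff_cutoff (n := 1) ((n : ℝ) + 1)))).aestronglyMeasurable) (hi.const_mul _)
      (fun n => Eventually.of_forall fun y => by rw [Real.norm_eq_abs]; exact hpt n y)
      (Eventually.of_forall hlim)
    simpa using h
  have h2 : Tendsto (fun n : ℕ => ∫ y, cutoff ((n : ℝ) + 1) y * VectorCalculus.divergence F y) atTop
      (𝓝 (∫ y, VectorCalculus.divergence F y)) := by
    refine tendsto_integral_of_dominated_convergence (fun y => ‖VectorCalculus.divergence F y‖)
      (fun n => ((contDiff_cutoff (n := 0) _).continuous.mul
        (continuous_divergence (hF.continuous_fderiv one_ne_zero))).aestronglyMeasurable)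
      hd.norm (fun n => Eventually.of_forall fun y => ?_) (Eventually.of_forall fun y => ?_)
    · rw [norm_mul, Real.norm_eq_abs]
      exact mul_le_of_le_one_left (norm_nonneg _) (abs_cutoff_le_one _ _)
    · simpa using (tendsto_cutoff_natCast_add_one y).mul_const (VectorCalculus.divergence F y)
  have h3 : Tendsto (fun n : ℕ => ∫ y, cutoff ((n : ℝ) + 1) y * VectorCalculus.divergence F y) atTop (𝓝 0) := by
    simp only [hibp]; exact h1
  exact tendsto_nhds_unique h2 h3

variable {F' : Type*} [NormedAddCommGroup F'] [InnerProductSpace ℝ F']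

omit [FiniteDimensional ℝ E] [MeasurableSpace E] [BorelSpace E] in
/-- `D(½‖Ω‖²)(x) h = ⟪DΩ(x) h, Ω x⟫`. [folklore] -/
theorem fderiv_half_norm_sq_apply {Ω : E → F'} {x : E} (hΩ : DifferentiableAt ℝ Ω x) (h : E) :
    fderiv ℝ (fun y => (1 / 2 : ℝ) * ‖Ω y‖ ^ 2) x h = ⟪fderiv ℝ Ω x h, Ω x⟫ := by
  rw [fderiv_const_mul (hΩ.norm_sq ℝ), hΩ.hasFDerivAt.norm_sq.fderiv]
  simp only [FunLike.coe_smul, Pi.smul_apply, ContinuousLinearMap.coe_comp, comp_apply,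
    innerSL_apply_apply, smul_eq_mul, real_inner_comm (Ω x)]
  ring

/-- **The transport term vanishes**: for a bounded divergence-free `C¹` wind `W` and a `C¹` field
`Ω` with `|Ω|²` and `|Ω| ‖DΩ‖` integrable, `∫ ⟪(W·∇)Ω, Ω⟫ = 0`
(`⟪DΩ(W), Ω⟫ = div(½|Ω|² W)` and `∫ div = 0`). [cite: MajdaBertozziCUP2002, §3.1.1 p. 87] -/
theorem integral_inner_fderiv_apply_self_eq_zero_of_bounded {W : E → E} {Ω : E → F'}
    (hW : ContDiff ℝ 1 W) (hdiv : VectorCalculus.IsDivFree W) {CW : ℝ} (hWb : ∀ y, ‖W y‖ ≤ CW)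
    (hΩ : ContDiff ℝ 1 Ω) (h2 : Integrable fun y => ‖Ω y‖ ^ 2)
    (hD : Integrable fun y => ‖Ω y‖ * ‖fderiv ℝ Ω y‖) :
    ∫ y, ⟪fderiv ℝ Ω y (W y), Ω y⟫ = 0 := by
  haveI : CompleteSpace E := FiniteDimensional.complete ℝ E
  have hCW : 0 ≤ CW := (norm_nonneg _).trans (hWb 0)
  have hθ : ContDiff ℝ 1 (fun y => (1 / 2 : ℝ) * ‖Ω y‖ ^ 2) := contDiff_const.mul (hΩ.norm_sq ℝ)
  have hΩd : ∀ y, DifferentiableAt ℝ Ω y := fun y => hΩ.differentiable one_ne_zero y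
  have hWd : ∀ y, DifferentiableAt ℝ W y := fun y => hW.differentiable one_ne_zero y
  have hθd : ∀ y, DifferentiableAt ℝ (fun y => (1 / 2 : ℝ) * ‖Ω y‖ ^ 2) y := fun y =>
    hθ.differentiable one_ne_zero y
  -- the flux and its divergence
  have hdivF : ∀ y, VectorCalculus.divergence (fun z => ((1 / 2 : ℝ) * ‖Ω z‖ ^ 2) • W z) y =
      ⟪fderiv ℝ Ω y (W y), Ω y⟫ := by
    intro y
    rw [divergence_smul_apply (hθd y) (hWd y), hdiv y, mul_zero, zero_add, gradient, real_inner_comm,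
      InnerProductSpace.toDual_symm_apply, fderiv_half_norm_sq_apply (hΩd y)]
  have hF1 : ContDiff ℝ 1 (fun z => ((1 / 2 : ℝ) * ‖Ω z‖ ^ 2) • W z) := hθ.smul hW
  have hFi : Integrable fun y => ‖((1 / 2 : ℝ) * ‖Ω y‖ ^ 2) • W y‖ / (1 + ‖y‖) := by
    refine ((h2.const_mul ((1 / 2) * CW))).mono' ?_ (Eventually.of_forall fun y => ?_)
    · exact ((hF1.continuous.norm).div (continuous_const.add continuous_norm)
        fun y => (by positivity : (0 : ℝ) < 1 + ‖y‖).ne').aestronglyMeasurable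
    · rw [Real.norm_eq_abs, abs_of_nonneg (by positivity), norm_smul, Real.norm_eq_abs, abs_of_nonneg (by positivity)]
      have h1 : 1 ≤ 1 + ‖y‖ := by linarith [norm_nonneg y]
      calc (1 / 2 : ℝ) * ‖Ω y‖ ^ 2 * ‖W y‖ / (1 + ‖y‖) ≤ (1 / 2 : ℝ) * ‖Ω y‖ ^ 2 * ‖W y‖ :=
            div_le_self (by positivity) h1
        _ ≤ (1 / 2 : ℝ) * ‖Ω y‖ ^ 2 * CW := mul_le_mul_of_nonneg_left (hWb y) (by positivity)
        _ = 1 / 2 * CW * ‖Ω y‖ ^ 2 := by ring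
  have hdi : Integrable fun y => VectorCalculus.divergence (fun z => ((1 / 2 : ℝ) * ‖Ω z‖ ^ 2) • W z) y := by
    simp_rw [hdivF]
    refine (hD.const_mul CW).mono' ?_ (Eventually.of_forall fun y => ?_)
    · exact (((hΩ.continuous_fderiv one_ne_zero).clm_apply hW.continuous).inner hΩ.continuous).aestronglyMeasurable
    · rw [Real.norm_eq_abs]
      calc |⟪fderiv ℝ Ω y (W y), Ω y⟫| ≤ ‖fderiv ℝ Ω y (W y)‖ * ‖Ω y‖ := abs_real_inner_le_norm _ _
        _ ≤ ‖fderiv ℝ Ω y‖ * ‖W y‖ * ‖Ω y‖ :=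
            mul_le_mul_of_nonneg_right ((fderiv ℝ Ω y).le_opNorm _) (norm_nonneg _)
        _ ≤ ‖fderiv ℝ Ω y‖ * CW * ‖Ω y‖ :=
            mul_le_mul_of_nonneg_right (mul_le_mul_of_nonneg_left (hWb y) (norm_nonneg _)) (norm_nonneg _)
        _ = CW * (‖Ω y‖ * ‖fderiv ℝ Ω y‖) := by ring
  have h := integral_divergence_eq_zero_of_integrable_div hF1 hFi hdi
  simp_rw [hdivF] at h
  exact h

/-- **The dilation term**: for a `C¹` field `Ω` with `|Ω|²` and `|y| |Ω| ‖DΩ‖` integrable,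
`∫ ⟪(y·∇)Ω, Ω⟫ = −(d/2) ∫ |Ω|²` (`d = dim E`; `⟪DΩ(y), Ω⟫ + (d/2)|Ω|² = div(½|Ω|² y)` and the
flux `½|Ω|² y`, although possibly not integrable, satisfies the logarithmic flux condition).
[folklore] -/
theorem integral_inner_fderiv_apply_id_self_eq {Ω : E → F'} (hΩ : ContDiff ℝ 1 Ω)
    (h2 : Integrable fun y => ‖Ω y‖ ^ 2)
    (hD : Integrable fun y => ‖y‖ * (‖Ω y‖ * ‖fderiv ℝ Ω y‖)) :
    ∫ y, ⟪fderiv ℝ Ω y y, Ω y⟫ = -(Module.finrank ℝ E / 2) * ∫ y, ‖Ω y‖ ^ 2 := by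
  haveI : CompleteSpace E := FiniteDimensional.complete ℝ E
  have hθ : ContDiff ℝ 1 (fun y => (1 / 2 : ℝ) * ‖Ω y‖ ^ 2) := contDiff_const.mul (hΩ.norm_sq ℝ)
  have hΩd : ∀ y, DifferentiableAt ℝ Ω y := fun y => hΩ.differentiable one_ne_zero y
  have hθd : ∀ y, DifferentiableAt ℝ (fun y => (1 / 2 : ℝ) * ‖Ω y‖ ^ 2) y := fun y =>
    hθ.differentiable one_ne_zero y
  have hdivid : ∀ y : E, VectorCalculus.divergence (fun z : E => z) y = Module.finrank ℝ E := fun y => by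
    rw [VectorCalculus.divergence, fderiv_fun_id, ContinuousLinearMap.coe_id, LinearMap.trace_id]
  have hdivF : ∀ y, VectorCalculus.divergence (fun z => ((1 / 2 : ℝ) * ‖Ω z‖ ^ 2) • z) y =
      ⟪fderiv ℝ Ω y y, Ω y⟫ + Module.finrank ℝ E / 2 * ‖Ω y‖ ^ 2 := by
    intro y
    rw [divergence_smul_apply (u := fun z : E => z) (hθd y) differentiableAt_id, hdivid y, gradient,
      real_inner_comm, InnerProductSpace.toDual_symm_apply, fderiv_half_norm_sq_apply (hΩd y)]
    ring
  have hF1 : ContDiff ℝ 1 (fun z : E => ((1 / 2 : ℝ) * ‖Ω z‖ ^ 2) • z) := hθ.smul contDiff_id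
  have hFi : Integrable fun y => ‖((1 / 2 : ℝ) * ‖Ω y‖ ^ 2) • y‖ / (1 + ‖y‖) := by
    refine ((h2.const_mul (1 / 2))).mono' ?_ (Eventually.of_forall fun y => ?_)
    · exact ((hF1.continuous.norm).div (continuous_const.add continuous_norm)
        fun y => (by positivity : (0 : ℝ) < 1 + ‖y‖).ne').aestronglyMeasurable
    · rw [Real.norm_eq_abs, abs_of_nonneg (by positivity), norm_smul, Real.norm_eq_abs, abs_of_nonneg (by positivity)]
      have h1 : 0 < 1 + ‖y‖ := by positivity
      rw [div_le_iff₀ h1]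
      nlinarith [norm_nonneg y, sq_nonneg ‖Ω y‖]
  have hinner : Integrable fun y => ⟪fderiv ℝ Ω y y, Ω y⟫ := by
    refine hD.mono' ?_ (Eventually.of_forall fun y => ?_)
    · exact (((hΩ.continuous_fderiv one_ne_zero).clm_apply continuous_id).inner hΩ.continuous).aestronglyMeasurable
    · rw [Real.norm_eq_abs]
      calc |⟪fderiv ℝ Ω y y, Ω y⟫| ≤ ‖fderiv ℝ Ω y y‖ * ‖Ω y‖ := abs_real_inner_le_norm _ _
        _ ≤ ‖fderiv ℝ Ω y‖ * ‖y‖ * ‖Ω y‖ :=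
            mul_le_mul_of_nonneg_right ((fderiv ℝ Ω y).le_opNorm _) (norm_nonneg _)
        _ = ‖y‖ * (‖Ω y‖ * ‖fderiv ℝ Ω y‖) := by ring
  have hdi : Integrable fun y => VectorCalculus.divergence (fun z => ((1 / 2 : ℝ) * ‖Ω z‖ ^ 2) • z) y := by
    simp_rw [hdivF]
    exact hinner.add (h2.const_mul _)
  have h := integral_divergence_eq_zero_of_integrable_div hF1 hFi hdi
  simp_rw [hdivF] at h
  rw [integral_add hinner (h2.const_mul _), integral_const_mul] at h
  linarith

omit [MeasurableSpace E] [BorelSpace E] in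
/-- `div (∇φ) = Δφ` for `C²` functions. [folklore] -/
private theorem divergence_gradient' {φ : E → ℝ} (hφ : ContDiff ℝ 2 φ) (x : E) :
    VectorCalculus.divergence (gradient φ) x = (Δ φ) x := by
  haveI : CompleteSpace E := FiniteDimensional.complete ℝ E
  set b := stdOrthonormalBasis ℝ E
  rw [divergence_eq_sum_inner_fderiv b, laplacian_eq_sum_fderiv_fderiv b hφ]
  refine Finset.sum_congr rfl fun i _ => ?_
  have hd : DifferentiableAt ℝ (fderiv ℝ φ) x :=
    ((hφ.fderiv_right (m := 1) le_rfl).differentiable one_ne_zero) x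
  have e1 : gradient φ = (toDual ℝ E).symm.toContinuousLinearEquiv ∘ fderiv ℝ φ := rfl
  rw [e1, ContinuousLinearEquiv.comp_fderiv, fderiv_clm_apply hd (differentiableAt_const _)]
  simp only [ContinuousLinearMap.coe_comp, ContinuousLinearEquiv.coe_coe, Function.comp_apply,
    LinearIsometryEquiv.coe_toContinuousLinearEquiv, fderiv_fun_const, Pi.zero_apply,
    ContinuousLinearMap.comp_zero, zero_add, ContinuousLinearMap.flip_apply]
  rw [real_inner_comm, InnerProductSpace.toDual_symm_apply]

omit [MeasurableSpace E] [BorelSpace E] in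
/-- The gradient of a `C^{n+1}` function is `Cⁿ`. [folklore] -/
private theorem contDiff_gradient' {φ : E → ℝ} {n : ℕ∞} (hφ : ContDiff ℝ (n + 1) φ) :
    ContDiff ℝ n (gradient φ) := by
  haveI : CompleteSpace E := FiniteDimensional.complete ℝ E
  have e1 : gradient φ = fun y => (toDual ℝ E).symm (fderiv ℝ φ y) := rfl
  rw [e1]
  exact (toDual ℝ E).symm.toContinuousLinearEquiv.contDiff.comp (hφ.fderiv_right le_rfl)

omit [MeasurableSpace E] [BorelSpace E] in
/-- `|DΩ|²_F ≤ d ‖DΩ‖²`. [folklore] -/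
theorem frobeniusNormSq_le_finrank_mul_norm_sq (L : E →L[ℝ] E) : frobeniusNormSq L ≤ Module.finrank ℝ E * ‖L‖ ^ 2 := by
  rw [frobeniusNormSq_eq_sum (stdOrthonormalBasis ℝ E)]
  have h : ∀ i, ‖L (stdOrthonormalBasis ℝ E i)‖ ^ 2 ≤ ‖L‖ ^ 2 := fun i => by
    have h1 : ‖L (stdOrthonormalBasis ℝ E i)‖ ≤ ‖L‖ := by
      simpa [(stdOrthonormalBasis ℝ E).orthonormal.1 i] using L.le_opNorm (stdOrthonormalBasis ℝ E i)
    exact pow_le_pow_left₀ (norm_nonneg _) h1 2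
  calc ∑ i, ‖L (stdOrthonormalBasis ℝ E i)‖ ^ 2 ≤ ∑ _i : Fin (Module.finrank ℝ E), ‖L‖ ^ 2 :=
        Finset.sum_le_sum fun i _ => h i
    _ = Module.finrank ℝ E * ‖L‖ ^ 2 := by simp

/-- **Green's identity on the whole space**: for a `C²` field `Ω : E → E` with `|Ω| ‖DΩ‖`,
`‖DΩ‖²` and `|ΔΩ| |Ω|` integrable, `∫ ⟪ΔΩ, Ω⟫ = −∫ |DΩ|²_F`
(`⟪ΔΩ,Ω⟫ + |DΩ|²_F = ½Δ|Ω|² = div(∇(½|Ω|²))` and `∫ div = 0`, the flux `|∇(½|Ω|²)| ≤ |Ω|‖DΩ‖`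
being integrable). [cite: MajdaBertozziCUP2002, §3.1.1 p. 87] -/
theorem integral_inner_laplacian_self_eq_neg {Ω : E → E} (hΩ : ContDiff ℝ 2 Ω)
    (hD : Integrable fun y => ‖Ω y‖ * ‖fderiv ℝ Ω y‖)
    (hD2 : Integrable fun y => ‖fderiv ℝ Ω y‖ ^ 2)
    (hL : Integrable fun y => ‖(Δ Ω) y‖ * ‖Ω y‖) :
    Integrable (fun y => frobeniusNormSq (fderiv ℝ Ω y)) ∧
      ∫ y, ⟪(Δ Ω) y, Ω y⟫ = -∫ y, frobeniusNormSq (fderiv ℝ Ω y) := by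
  haveI : CompleteSpace E := FiniteDimensional.complete ℝ E
  have hΩ1 : ContDiff ℝ 1 Ω := hΩ.of_le one_le_two
  have hΩd : ∀ y, DifferentiableAt ℝ Ω y := fun y => hΩ1.differentiable one_ne_zero y
  have hθ : ContDiff ℝ 2 (fun y => (1 / 2 : ℝ) * ‖Ω y‖ ^ 2) := contDiff_const.mul (hΩ.norm_sq ℝ)
  -- integrability of the Frobenius term and of `⟪ΔΩ, Ω⟫`
  have hDc : Continuous (fderiv ℝ Ω) := hΩ1.continuous_fderiv one_ne_zero
  have hFc : Continuous fun y => frobeniusNormSq (fderiv ℝ Ω y) := by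
    simp only [frobeniusNormSq]
    exact continuous_finsetSum _ fun i _ => (hDc.clm_apply continuous_const).norm.pow 2
  have hFi : Integrable fun y => frobeniusNormSq (fderiv ℝ Ω y) :=
    (hD2.const_mul _).mono' hFc.aestronglyMeasurable (Eventually.of_forall fun y => by
      rw [Real.norm_eq_abs, abs_of_nonneg (frobeniusNormSq_nonneg _)]
      exact frobeniusNormSq_le_finrank_mul_norm_sq _)
  have hLi : Integrable fun y => ⟪(Δ Ω) y, Ω y⟫ :=
    hL.mono' ((continuous_laplacian hΩ).inner hΩ.continuous).aestronglyMeasurable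
      (Eventually.of_forall fun y => by rw [Real.norm_eq_abs]; exact abs_real_inner_le_norm _ _)
  refine ⟨hFi, ?_⟩
  -- the flux `∇(½|Ω|²)` and its divergence
  have hdiv : ∀ y, VectorCalculus.divergence (gradient fun y => (1 / 2 : ℝ) * ‖Ω y‖ ^ 2) y =
      ⟪(Δ Ω) y, Ω y⟫ + frobeniusNormSq (fderiv ℝ Ω y) := by
    intro y
    rw [divergence_gradient' hθ]
    have e : (fun y => (1 / 2 : ℝ) * ‖Ω y‖ ^ 2) = (1 / 2 : ℝ) • fun y => ⟪Ω y, Ω y⟫ := by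
      funext z; simp
    rw [e, laplacian_smul _ ((hΩ.inner ℝ hΩ).contDiffAt), laplacian_inner_self_eq hΩ, smul_eq_mul]
    ring
  have hF1 : ContDiff ℝ 1 (gradient fun y => (1 / 2 : ℝ) * ‖Ω y‖ ^ 2) := contDiff_gradient' hθ
  have hFi' : Integrable fun y => ‖gradient (fun y => (1 / 2 : ℝ) * ‖Ω y‖ ^ 2) y‖ / (1 + ‖y‖) := by
    refine hD.mono' ?_ (Eventually.of_forall fun y => ?_)
    · exact (hF1.continuous.norm.div (continuous_const.add continuous_norm)
        fun y => (by positivity : (0 : ℝ) < 1 + ‖y‖).ne').aestronglyMeasurable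
    · rw [Real.norm_eq_abs, abs_of_nonneg (by positivity)]
      have h1 : 1 ≤ 1 + ‖y‖ := by linarith [norm_nonneg y]
      refine (div_le_self (norm_nonneg _) h1).trans ?_
      rw [show ‖gradient (fun y => (1 / 2 : ℝ) * ‖Ω y‖ ^ 2) y‖ = ‖fderiv ℝ (fun y => (1 / 2 : ℝ) * ‖Ω y‖ ^ 2) y‖
        by simp [gradient]]
      refine ContinuousLinearMap.opNorm_le_bound _ (by positivity) fun h => ?_
      rw [fderiv_half_norm_sq_apply (hΩd y)]
      calc ‖⟪fderiv ℝ Ω y h, Ω y⟫‖ ≤ ‖fderiv ℝ Ω y h‖ * ‖Ω y‖ := norm_inner_le_norm _ _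
        _ ≤ ‖fderiv ℝ Ω y‖ * ‖h‖ * ‖Ω y‖ := mul_le_mul_of_nonneg_right ((fderiv ℝ Ω y).le_opNorm h) (norm_nonneg _)
        _ = ‖Ω y‖ * ‖fderiv ℝ Ω y‖ * ‖h‖ := by ring
  have hdi : Integrable fun y => VectorCalculus.divergence (gradient fun y => (1 / 2 : ℝ) * ‖Ω y‖ ^ 2) y := by
    simp_rw [hdiv]; exact hLi.add hFi
  have h := integral_divergence_eq_zero_of_integrable_div hF1 hFi' hdi
  simp_rw [hdiv] at h
  rw [integral_add hLi hFi] at h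
  linarith

end IBP

section Slice

/-- **The enstrophy identity in similarity variables, one slice (Pineau–Vicol (7.12), α-free
form).** For a classical solution `(V, P)` of the backward Leray system
`∂ₛV + ½V + ½(y·∇)V + (V·∇)V + ∇P = ΔV`, `div V = 0` on `ℝ × ℝ³` and a time `s` at which
`V(s)` is bounded and `Ω = curl V(s)` has `|Ω|²`, `(1+|y|)|Ω|‖DΩ‖`, `‖DΩ‖²`, `|ΔΩ||Ω|` and the
stretching density integrable (the time-derivative density then is, by the equation):
`∫ ⟪∂ₛΩ, Ω⟫ + ¼ ∫|Ω|² + ∫ |DΩ|²_F = ∫ ⟪Ω, (DV)Ω⟫`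
(inner product of the vorticity equation `∂ₛΩ + Ω + ½(y·∇)Ω + (V·∇)Ω = (Ω·∇)V + ΔΩ`
(`IsBackwardLeraySolutionOn.vorticity_eq`) with `Ω`; `∫⟪(y·∇)Ω,Ω⟫ = −(3/2)∫|Ω|²`,
`∫⟪(V·∇)Ω,Ω⟫ = 0`, `∫⟪ΔΩ,Ω⟫ = −∫|DΩ|²_F`). In the rotating frame of the source the same identity
carries the terms `α(JΩ − (Jy·∇)Ω)·Ω`, which vanish identically. [cite: PineauVicol2026, (7.12) and (3.3)] -/
theorem enstrophy_slice {V : ℝ → ℝ³ → ℝ³} {P : ℝ → ℝ³ → ℝ}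
    (h : IsBackwardLeraySolutionOn univ 1 V P) (s : ℝ) {C₀ : ℝ} (hVb : ∀ y, ‖V s y‖ ≤ C₀)
    (hΩ2 : Integrable fun y => ‖curl (V s) y‖ ^ 2)
    (hΩD : Integrable fun y => (1 + ‖y‖) * (‖curl (V s) y‖ * ‖fderiv ℝ (curl (V s)) y‖))
    (hDΩ2 : Integrable fun y => ‖fderiv ℝ (curl (V s)) y‖ ^ 2)
    (hL : Integrable fun y => ‖(Δ (curl (V s))) y‖ * ‖curl (V s) y‖)
    (hS : Integrable fun y => ⟪curl (V s) y, fderiv ℝ (V s) y (curl (V s) y)⟫) :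
    (∫ y, ⟪timeDerivWithin univ (vorticity V) s y, curl (V s) y⟫) + (1 / 4) * (∫ y, ‖curl (V s) y‖ ^ 2) +
        ∫ y, frobeniusNormSq (fderiv ℝ (curl (V s)) y) =
      ∫ y, ⟪curl (V s) y, fderiv ℝ (V s) y (curl (V s) y)⟫ := by
  have hVs : ContDiff ℝ ∞ (V s) := h.smooth_velocity.contDiff_slice (mem_univ s)
  have hV1 : ContDiff ℝ 1 (V s) := hVs.of_le (by norm_cast)
  have hV3 : ContDiff ℝ 3 (V s) := hVs.of_le (by norm_cast)
  have hdiv : VectorCalculus.IsDivFree (V s) := h.divFree s (mem_univ s)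
  have hΩ2c : ContDiff ℝ 2 (curl (V s)) := contDiff_two_curl hV3
  have hΩ1 : ContDiff ℝ 1 (curl (V s)) := hΩ2c.of_le one_le_two
  have hΩc : Continuous (curl (V s)) := hΩ1.continuous
  have hDΩc : Continuous (fderiv ℝ (curl (V s))) := hΩ1.continuous_fderiv one_ne_zero
  have hC₀ : 0 ≤ C₀ := (norm_nonneg _).trans (hVb 0)
  -- the pointwise equation
  have hpt : ∀ y, ⟪timeDerivWithin univ (vorticity V) s y, curl (V s) y⟫ =
      ⟪curl (V s) y, fderiv ℝ (V s) y (curl (V s) y)⟫ + ⟪(Δ (curl (V s))) y, curl (V s) y⟫ -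
        ‖curl (V s) y‖ ^ 2 - (1 / 2) * ⟪fderiv ℝ (curl (V s)) y y, curl (V s) y⟫ -
        ⟪fderiv ℝ (curl (V s)) y (V s y), curl (V s) y⟫ := by
    intro y
    have e := h.vorticity_eq uniqueDiffOn_univ (by simp) (mem_univ s) y
    simp only [vorticity_apply, convect_apply, one_smul] at e
    have e' : timeDerivWithin univ (vorticity V) s y = fderiv ℝ (V s) y (curl (V s) y) + (Δ (curl (V s))) y -
        curl (V s) y - (1 / 2 : ℝ) • fderiv ℝ (curl (V s)) y y - fderiv ℝ (curl (V s)) y (V s y) := by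
      rw [← e]; abel
    rw [e', inner_sub_left, inner_sub_left, inner_sub_left, inner_add_left, inner_smul_left,
      real_inner_self_eq_norm_sq, real_inner_comm (curl (V s) y) (fderiv ℝ (V s) y (curl (V s) y))]
    simp
  -- integrability of the pieces
  have hΩDi : Integrable fun y => ‖curl (V s) y‖ * ‖fderiv ℝ (curl (V s)) y‖ :=
    hΩD.mono' (hΩc.norm.mul hDΩc.norm).aestronglyMeasurable (Eventually.of_forall fun y => by
      rw [Real.norm_eq_abs, abs_of_nonneg (by positivity)]
      have h1 : (1 : ℝ) ≤ 1 + ‖y‖ := by linarith [norm_nonneg y]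
      nlinarith [mul_nonneg (norm_nonneg (curl (V s) y)) (norm_nonneg (fderiv ℝ (curl (V s)) y))])
  have hyΩDi : Integrable fun y => ‖y‖ * (‖curl (V s) y‖ * ‖fderiv ℝ (curl (V s)) y‖) :=
    hΩD.mono' ((continuous_norm).mul (hΩc.norm.mul hDΩc.norm)).aestronglyMeasurable (Eventually.of_forall fun y => by
      rw [Real.norm_eq_abs, abs_of_nonneg (by positivity)]
      nlinarith [mul_nonneg (norm_nonneg (curl (V s) y)) (norm_nonneg (fderiv ℝ (curl (V s)) y)), norm_nonneg y])
  have iL : Integrable fun y => ⟪(Δ (curl (V s))) y, curl (V s) y⟫ :=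
    hL.mono' ((continuous_laplacian hΩ2c).inner hΩc).aestronglyMeasurable
      (Eventually.of_forall fun y => by rw [Real.norm_eq_abs]; exact abs_real_inner_le_norm _ _)
  have iD : Integrable fun y => ⟪fderiv ℝ (curl (V s)) y y, curl (V s) y⟫ :=
    hyΩDi.mono' ((hDΩc.clm_apply continuous_id).inner hΩc).aestronglyMeasurable (Eventually.of_forall fun y => by
      rw [Real.norm_eq_abs]
      calc |⟪fderiv ℝ (curl (V s)) y y, curl (V s) y⟫| ≤ ‖fderiv ℝ (curl (V s)) y y‖ * ‖curl (V s) y‖ :=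
            abs_real_inner_le_norm _ _
        _ ≤ ‖fderiv ℝ (curl (V s)) y‖ * ‖y‖ * ‖curl (V s) y‖ :=
            mul_le_mul_of_nonneg_right ((fderiv ℝ (curl (V s)) y).le_opNorm y) (norm_nonneg _)
        _ = ‖y‖ * (‖curl (V s) y‖ * ‖fderiv ℝ (curl (V s)) y‖) := by ring)
  have iT : Integrable fun y => ⟪fderiv ℝ (curl (V s)) y (V s y), curl (V s) y⟫ :=
    (hΩDi.const_mul C₀).mono' ((hDΩc.clm_apply hVs.continuous).inner hΩc).aestronglyMeasurable
      (Eventually.of_forall fun y => by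
        rw [Real.norm_eq_abs]
        calc |⟪fderiv ℝ (curl (V s)) y (V s y), curl (V s) y⟫| ≤ ‖fderiv ℝ (curl (V s)) y (V s y)‖ * ‖curl (V s) y‖ :=
              abs_real_inner_le_norm _ _
          _ ≤ ‖fderiv ℝ (curl (V s)) y‖ * ‖V s y‖ * ‖curl (V s) y‖ :=
              mul_le_mul_of_nonneg_right ((fderiv ℝ (curl (V s)) y).le_opNorm _) (norm_nonneg _)
          _ ≤ ‖fderiv ℝ (curl (V s)) y‖ * C₀ * ‖curl (V s) y‖ :=
              mul_le_mul_of_nonneg_right (mul_le_mul_of_nonneg_left (hVb y) (norm_nonneg _)) (norm_nonneg _)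
          _ = C₀ * (‖curl (V s) y‖ * ‖fderiv ℝ (curl (V s)) y‖) := by ring)
  -- the three integral identities
  have e1 : ∫ y, ⟪fderiv ℝ (curl (V s)) y y, curl (V s) y⟫ = -(3 / 2) * ∫ y, ‖curl (V s) y‖ ^ 2 := by
    have := integral_inner_fderiv_apply_id_self_eq hΩ1 hΩ2 hyΩDi
    rw [this]; congr 1; simp
  have e2 : ∫ y, ⟪fderiv ℝ (curl (V s)) y (V s y), curl (V s) y⟫ = 0 :=
    integral_inner_fderiv_apply_self_eq_zero_of_bounded hV1 hdiv hVb hΩ1 hΩ2 hΩDi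
  obtain ⟨hFi, e3⟩ := integral_inner_laplacian_self_eq_neg hΩ2c hΩDi hDΩ2 hL
  -- integrate the pointwise identity
  have key : ∫ y, ⟪timeDerivWithin univ (vorticity V) s y, curl (V s) y⟫ =
      (∫ y, ⟪curl (V s) y, fderiv ℝ (V s) y (curl (V s) y)⟫) + (∫ y, ⟪(Δ (curl (V s))) y, curl (V s) y⟫) -
        (∫ y, ‖curl (V s) y‖ ^ 2) - (1 / 2) * (∫ y, ⟪fderiv ℝ (curl (V s)) y y, curl (V s) y⟫) -
        ∫ y, ⟪fderiv ℝ (curl (V s)) y (V s y), curl (V s) y⟫ := by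
    have i1 : Integrable fun a => ⟪curl (V s) a, fderiv ℝ (V s) a (curl (V s) a)⟫ + ⟪(Δ (curl (V s))) a, curl (V s) a⟫ :=
      hS.add iL
    have i2 : Integrable fun a => ⟪curl (V s) a, fderiv ℝ (V s) a (curl (V s) a)⟫ + ⟪(Δ (curl (V s))) a, curl (V s) a⟫ -
        ‖curl (V s) a‖ ^ 2 := i1.sub hΩ2
    have i3 : Integrable fun a => (1 / 2 : ℝ) * ⟪fderiv ℝ (curl (V s)) a a, curl (V s) a⟫ := iD.const_mul _
    have i4 : Integrable fun a => ⟪curl (V s) a, fderiv ℝ (V s) a (curl (V s) a)⟫ + ⟪(Δ (curl (V s))) a, curl (V s) a⟫ -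
        ‖curl (V s) a‖ ^ 2 - (1 / 2 : ℝ) * ⟪fderiv ℝ (curl (V s)) a a, curl (V s) a⟫ := i2.sub i3
    rw [integral_congr_ae (Eventually.of_forall hpt), integral_sub i4 iT, integral_sub i2 i3, integral_sub i1 hΩ2,
      integral_add hS iL, integral_const_mul]
  rw [key, e1, e2, e3]
  ring

/-- **Period integration and absorption (Pineau–Vicol §7.5, α-free form).** Let `(V, P)` solve the
backward Leray system on `ℝ × ℝ³` with, for every `s ∈ [0, S]`: `|V| ≤ C₀`, `V(s) ∈ L⁴`, the
slice integrability hypotheses of `enstrophy_slice`, `‖DV(s)‖ ≤ ⅛` outside `B(0, R̄)`, and the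
local smallness `‖Ω(s)‖_{L²(B_R̄)} ≤ δ` with `C_Ω δ < ⅛`. If moreover the time term integrates to
zero over `[0, S]` (periodicity of `s ↦ ‖Ω(s)‖₂`: `∫₀^S ∫⟪∂ₛΩ, Ω⟫ = ½(‖Ω(S)‖₂² − ‖Ω(0)‖₂²) = 0`) and
`s ↦ ‖Ω(s)‖₂²` is continuous, `s ↦ ∫|DΩ(s)|²_F`, `s ↦ ∫⟪Ω,(DV)Ω⟫` interval integrable, then
`Ω ≡ 0` on `[0, S] × ℝ³`: integrating the slice identity,
`∫₀^S (¼‖Ω‖₂² + ‖DΩ‖²_F) ≤ ∫₀^S (⅛‖Ω‖₂² + C_Ω δ (‖Ω‖₂² + ‖DΩ‖₂²))`, and `‖DΩ‖₂² ≤ ‖DΩ‖²_F`.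
[cite: PineauVicol2026, §7.5 (proof of Thm. 1.7, small |α|), (7.12) and Proposition 3.1] -/
theorem curl_eq_zero_of_small_local_enstrophy {V : ℝ → ℝ³ → ℝ³} {P : ℝ → ℝ³ → ℝ}
    (h : IsBackwardLeraySolutionOn univ 1 V P) {S : ℝ} (hS0 : 0 < S) {C₀ R δ : ℝ}
    (hVb : ∀ s ∈ Icc 0 S, ∀ y, ‖V s y‖ ≤ C₀)
    (h4 : ∀ s ∈ Icc 0 S, MemLp (V s) 4 volume)
    (hΩ2 : ∀ s ∈ Icc 0 S, Integrable fun y => ‖curl (V s) y‖ ^ 2)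
    (hΩD : ∀ s ∈ Icc 0 S, Integrable fun y => (1 + ‖y‖) * (‖curl (V s) y‖ * ‖fderiv ℝ (curl (V s)) y‖))
    (hDΩ2 : ∀ s ∈ Icc 0 S, Integrable fun y => ‖fderiv ℝ (curl (V s)) y‖ ^ 2)
    (hL : ∀ s ∈ Icc 0 S, Integrable fun y => ‖(Δ (curl (V s))) y‖ * ‖curl (V s) y‖)
    (hsmall : ∀ s ∈ Icc 0 S, ∀ y, R ≤ ‖y‖ → ‖fderiv ℝ (V s) y‖ ≤ 1 / 8)
    (hδ : ∀ s ∈ Icc 0 S, Real.sqrt (∫ y in Metric.ball 0 R, ‖curl (V s) y‖ ^ 2) ≤ δ)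
    (hδC : vortexConst * δ < 1 / 8)
    (htime : ∫ s in (0 : ℝ)..S, (∫ y, ⟪timeDerivWithin univ (vorticity V) s y, curl (V s) y⟫) = 0)
    (ha : ContinuousOn (fun s => ∫ y, ‖curl (V s) y‖ ^ 2) (Icc 0 S))
    (hb : IntervalIntegrable (fun s => ∫ y, frobeniusNormSq (fderiv ℝ (curl (V s)) y)) volume 0 S)
    (hst : IntervalIntegrable (fun s => ∫ y, ⟪curl (V s) y, fderiv ℝ (V s) y (curl (V s) y)⟫) volume 0 S) :
    ∀ s ∈ Icc 0 S, ∀ y, curl (V s) y = 0 := by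
  -- notation for the slice quantities
  set a : ℝ → ℝ := fun s => ∫ y, ‖curl (V s) y‖ ^ 2 with ha_def
  set bF : ℝ → ℝ := fun s => ∫ y, frobeniusNormSq (fderiv ℝ (curl (V s)) y) with hbF
  set bO : ℝ → ℝ := fun s => ∫ y, ‖fderiv ℝ (curl (V s)) y‖ ^ 2 with hbO
  set St : ℝ → ℝ := fun s => ∫ y, ⟪curl (V s) y, fderiv ℝ (V s) y (curl (V s) y)⟫ with hSt
  set T : ℝ → ℝ := fun s => ∫ y, ⟪timeDerivWithin univ (vorticity V) s y, curl (V s) y⟫ with hT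
  have hδ0 : 0 ≤ δ := le_trans (Real.sqrt_nonneg _) (hδ 0 ⟨le_rfl, hS0.le⟩)
  have hC := vortexConst_nonneg
  -- slice facts
  have hslice : ∀ s ∈ Icc 0 S, T s + (1 / 4) * a s + bF s = St s ∧ 0 ≤ a s ∧ bO s ≤ bF s ∧ 0 ≤ bO s ∧
      St s ≤ (1 / 8) * a s + vortexConst * δ * (a s + bO s) := by
    intro s hs
    have hVs : ContDiff ℝ ∞ (V s) := h.smooth_velocity.contDiff_slice (mem_univ s)
    have hV3 : ContDiff ℝ 3 (V s) := hVs.of_le (by norm_cast)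
    have hdiv : VectorCalculus.IsDivFree (V s) := h.divFree s (mem_univ s)
    obtain ⟨hSi, hSle⟩ := integral_inner_curl_fderiv_curl_le hV3 hdiv (h4 s hs) (hΩ2 s hs) (hDΩ2 s hs) (hsmall s hs)
    have e := enstrophy_slice h s (hVb s hs) (hΩ2 s hs) (hΩD s hs) (hDΩ2 s hs) (hL s hs) hSi
    have hΩ1 : ContDiff ℝ 1 (curl (V s)) := (contDiff_two_curl hV3).of_le one_le_two
    have hDΩc : Continuous (fderiv ℝ (curl (V s))) := hΩ1.continuous_fderiv one_ne_zero
    obtain ⟨hFi, -⟩ := integral_inner_laplacian_self_eq_neg (contDiff_two_curl hV3)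
      ((hΩD s hs).mono' ((contDiff_two_curl hV3).continuous.norm.mul hDΩc.norm).aestronglyMeasurable
        (Eventually.of_forall fun y => by
          rw [Real.norm_eq_abs, abs_of_nonneg (by positivity)]
          have h1 : (1 : ℝ) ≤ 1 + ‖y‖ := by linarith [norm_nonneg y]
          nlinarith [mul_nonneg (norm_nonneg (curl (V s) y)) (norm_nonneg (fderiv ℝ (curl (V s)) y))]))
      (hDΩ2 s hs) (hL s hs)
    refine ⟨e, integral_nonneg fun y => sq_nonneg _, ?_, integral_nonneg fun y => sq_nonneg _, ?_⟩
    · exact integral_mono (hDΩ2 s hs) hFi fun y => norm_sq_le_frobeniusNormSq _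
    · refine hSle.trans ?_
      have ha0 : 0 ≤ a s := integral_nonneg fun y => sq_nonneg _
      have hb0 : 0 ≤ bO s := integral_nonneg fun y => sq_nonneg _
      have := hδ s hs
      show (1 / 8) * a s + vortexConst * Real.sqrt (∫ y in Metric.ball 0 R, ‖curl (V s) y‖ ^ 2) * (a s + bO s) ≤
        (1 / 8) * a s + vortexConst * δ * (a s + bO s)
      nlinarith [mul_le_mul_of_nonneg_left this hC, mul_nonneg hC (Real.sqrt_nonneg (∫ y in Metric.ball 0 R, ‖curl (V s) y‖ ^ 2))]
  -- the key pointwise-in-`s` inequality: `(⅛ − C_Ωδ) a + (1 − C_Ωδ) bF ≤ −T`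
  have hkey : ∀ s ∈ Icc 0 S, (1 / 8 - vortexConst * δ) * a s ≤ -T s := by
    intro s hs
    obtain ⟨e, ha0, hbOF, hbO0, hSt⟩ := hslice s hs
    have hbF0 : 0 ≤ bF s := hbO0.trans hbOF
    nlinarith [mul_nonneg (mul_nonneg hC hδ0) hbF0, mul_nonneg (mul_nonneg hC hδ0) (sub_nonneg.2 hbOF)]
  -- integrate over the period
  have haI : IntervalIntegrable a volume 0 S := (ha.mono (by rw [uIcc_of_le hS0.le])).intervalIntegrable
  have hT_eq : EqOn T (fun s => St s - (1 / 4) * a s - bF s) (Icc 0 S) := fun s hs => by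
    have := (hslice s hs).1
    show T s = St s - (1 / 4) * a s - bF s
    linarith
  have hTI : IntervalIntegrable T volume 0 S := by
    refine ((hst.sub (haI.const_mul (1 / 4))).sub hb).congr_uIoo fun s hs => ?_
    have hs' : s ∈ Icc 0 S := by
      have : s ∈ Ioo 0 S := by simpa [uIoo, hS0.le] using hs
      exact Ioo_subset_Icc_self this
    exact (hT_eq hs').symm
  have hint : (1 / 8 - vortexConst * δ) * ∫ s in (0 : ℝ)..S, a s ≤ 0 := by
    have h1 := intervalIntegral.integral_mono_on hS0.le (haI.const_mul (1 / 8 - vortexConst * δ)) hTI.neg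
      (fun s hs => hkey s hs)
    rw [intervalIntegral.integral_const_mul] at h1
    have h2 : ∫ u in (0 : ℝ)..S, (-T) u = 0 := by
      rw [show (-T) = fun u => -T u from rfl, intervalIntegral.integral_neg, htime, neg_zero]
    linarith
  have hcoef : 0 < 1 / 8 - vortexConst * δ := by linarith
  have hIa : ∫ s in (0 : ℝ)..S, a s ≤ 0 := by
    by_contra hpos; push Not at hpos
    nlinarith
  -- hence `a ≡ 0` on `[0, S]`
  by_contra hne
  push Not at hne
  obtain ⟨s₀, hs₀, y₀, hy₀⟩ := hne
  have hVs : ContDiff ℝ ∞ (V s₀) := h.smooth_velocity.contDiff_slice (mem_univ s₀)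
  have hΩc : Continuous (curl (V s₀)) := (contDiff_two_curl (hVs.of_le (by norm_cast))).continuous
  have ha_pos : 0 < a s₀ := by
    show 0 < ∫ y, ‖curl (V s₀) y‖ ^ 2
    rw [integral_pos_iff_support_of_nonneg (fun y => sq_nonneg _) (hΩ2 s₀ hs₀)]
    have hopen : IsOpen (Function.support fun y => ‖curl (V s₀) y‖ ^ 2) :=
      isOpen_ne_fun (hΩc.norm.pow 2) continuous_const
    refine hopen.measure_pos volume ⟨y₀, ?_⟩
    simp [Function.mem_support, hy₀]
  have hlt := intervalIntegral.integral_lt_integral_of_continuousOn_of_le_of_exists_lt hS0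
    continuousOn_const ha (f := fun _ => (0 : ℝ)) (fun s hs => (hslice s (Ioc_subset_Icc_self hs)).2.1)
    ⟨s₀, hs₀, ha_pos⟩
  simp only [intervalIntegral.integral_zero] at hlt
  linarith

end Slice

end PineauVicol2026

end Literature.Analysis.FluidPDE
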